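import Literature.MathematicalPhysics.QuantumLattice.FermiRG.FST3GraphClassificationProofs
import HarnessLib

/-!
# Feldman–Salmhofer–Trubowitz III, Theorem 2.6 — PROOF (discharge of the named fact
# `FST3.theorem26`): a non-DOL two-legged skeleton graph is a sunset, a multiple sunset or a
# wicked ladder

Third theorem-only companion of `FermiRG/FST3GraphClassification.lean` (typer-wave file F5c of the
cell `gate-hubbard-kl`; source FST III = J. Feldman, M. Salmhofer, E. Trubowitz, *Regularity of
interacting nonspherical Fermi surfaces: the full self-energy*, Comm. Pure Appl. Math. **52** (1999)
273–324, arXiv:cond-mat/9705272 [FeldmanSalmhoferTrubowitz1999], Chapter 2 "Classification of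
Skeleton Graphs"; locators `p000N:Ln` = chunk/line of the `lit read` TeX render, key
`paper:arxiv-cond-mat_9705272`, as in the statement file).  The statement file declares Theorem 2.6
as the named fact `theorem26 : Prop` (licence F-036) for the printed set-up (external legs at two
distinct vertices `a ≠ b`, shapes modulo self-contractions); the companion
`FST3GraphClassificationProofs.lean` (imported) proves Lemma 2.5 / Theorem 2.4 (`lemma25_holds`,
`isDOL_of_two_le_edist`), the chain lemma `isDOL_of_chain`, the parity counts and the ball/component
tools.  THIS file proves `theorem theorem26_holds : theorem26`.  It is finite graph theory on the
carrier `FGraph V L` of the statement file; no definition is introduced (the boundary `∂A` of a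
vertex set is written `linesBetween A Aᶜ`, "the line set `S` connects `W`" is written
`∀ v ∈ W, ∀ w ∈ W, G.Reachable S v w`, components of the subgraph spanned by `W` are passed as sets
`K` with `∀ x, x ∈ K ↔ G.Reachable (G.induced W) c x`).

## The printed proof (§2.2, p0006:L41–108) and how it is followed

FST: "we turn to the case `t = 1`.  We call the external vertices `v₀` and `v₁`.  If `G` has only
these two vertices, then `G` is the sunset … or the multiple sunset.  Otherwise, let `D` be the
subgraph of all other vertices … The connected components of `D` may be joined only to `v₀`, only
to `v₁`, or to `v₀` and `v₁` … If `D` is nonempty and `G₁` has at least one vertex in addition to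
`v₀`, then, by the definition of skeleton graphs, `G₁` is overlapping and hence `G` is DOL.
Otherwise … for `a ≥ 2` components … the graph is DOL … If `a = 1`, we consider `m ≥ 2` first …
they are DOL.  There remains the case `m = 1` … If `m₁ + n₁ = 4` … If any of the subgraphs drawn as
shaded disks is overlapping, `G` is DOL.  If the subgraphs are non-overlapping, they are dressed
bubble chains by Lemma 2.26 of [FST I].  Since `G` has `t = 1`, `G` must then look as in Figure 13
[DOL] or as in Figure 14 [the wicked ladder]" (p0006:L41–103).

Accordingly, with ONE DEVIATION: the last step of the print imports the classification of
non-overlapping four-legged graphs from FST I (Lemma 2.22/2.26 there); here it is replaced by a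
direct induction along the ladder driven by the same two principles the rest of §2 uses — the
parity/skeleton count of boundary lines and "three connected blocks with enough lines between them
are DOL" (the chain lemma) — so that no notion of FST I is needed.

* §1–§3: walks (closed sets, first exit), membership lemmas, the parity counts
  `three_le_card_bdry` / `even_card_bdry_of_not_mem` (odd `≥ 3` boundary lines for a vertex set
  holding exactly one external vertex, even `≠ 2` for one holding none) on top of the imported
  `subgraphLegs_induced` / `even_subgraphLegs`.
* §4–§5: hubs for connectivity, and the THREE-BLOCK LEMMA `isDOL_of_threeBlocks` (blocks `A`, `M`,
  `Z` connected, `|∂A| ≥ 3`, three `M`–`Z` lines ⇒ DOL) derived from the imported `isDOL_of_chain`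
  (the boundary line of `A` used as `θ` goes to `M` or to `Z`; the chain lemma is applied in the
  corresponding order).
* §6–§7: components of `G - {p, q}` for the two external vertices (closure, connectedness,
  `card_bdry_comp`: `|∂K| = m_K + n_K`, attachment to `p` or `q`, blocks "`p` plus components"),
  and `isDOL_of_comp`: a component with three lines to `q` makes `G` DOL.
* §8: line counts (`lineCount u v = |linesBetween {u} {v}|`, symmetry) and SEPARATION
  (`exists_separation`: two vertices of a connected block are separated by a partition into two
  connected blocks — the component of one in the block minus the other, and the rest).
* §9 = the reductions of §2.2: `t = 1` (`exists_joins_of_not_isDOL`, from Theorem 2.4); a component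
  joined to one external vertex only is DOL (`isDOL_of_oneSided` — "`G₁` is overlapping and hence
  `G` is DOL"); hence two lines from each component to each external vertex
  (`card_lines_comp_eq_two` — "`m_b + n_b = 4`", sharpened) and at most one component
  (`comp_eq_of_not_isDOL` — "for `a ≥ 2` components … DOL"); no component = sunset / multiple
  sunset (`sunset_of_eq_empty`); one component forces `m = 1` (`card_lines_ab_eq_one` — "we
  consider `m ≥ 2` first … DOL").
* §10 = the replacement of the FST I step: the LADDER INDUCTION.  A ladder state is a connected
  vertex set `P ∋ b`, `a ∉ P`, all of whose boundary lines other than the `a–b` line sit at one tip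
  vertex `u`, together with the vertices found so far `w : Fin (k+1) → V` (tip first, `b` last)
  and their line counts (two lines between consecutive ones, none otherwise).  `ladder_step`: the
  reduced boundary of `P` has exactly two lines and both join `u` to ONE new vertex `v` — the
  components of `G - a - P` are all joined to `a` and to `P` (`isDOL_of_ladderComp_not_a/_not_P`,
  three-block), `a` receives only two lines from inner vertices, a component with three lines into
  `P` is DOL (`false_of_ladderComp_three`), and two different end vertices are excluded by
  separation + parity (`ladder_ends_eq`); `v = a` exactly when every inner vertex is in `P`.
  `ladder_induction` runs this from `P = {b}` and assembles `IsWickedLadderShape a b (k+1)` with the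
  `Fin.cons` bookkeeping.
* §11: `theorem26_holds`.

Typer lint: no `instance`, no `notation`, no attribute changes; imports the first companion (hence
`Mathlib`, the statement file) and `HarnessLib` only; no `sorry`; axioms of `theorem26_holds` ⊆
{propext, Classical.choice, Quot.sound}.
-/

namespace Literature.MathematicalPhysics.QuantumLattice.FermiRG

namespace FST3

namespace FGraph

universe u v

variable {V : Type u} {L : Type v} (G : FGraph V L)

/-! ### §1 Walks: symmetry, monotonicity, closed sets, first exit -/

/-- Every line joins its two ends. [cite: FeldmanSalmhoferTrubowitz1999, §2.1 p0005:L57-60] -/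
theorem joins_fst_snd (l : L) : G.Joins l (G.fst l) (G.snd l) := Or.inl ⟨rfl, rfl⟩

/-- If `l` joins `v` and `w`, then `v` is an end of `l`. [cite: FeldmanSalmhoferTrubowitz1999, §2.1 p0005:L57-60] -/
theorem Joins.eq_fst_or_eq_snd {G : FGraph V L} {l : L} {v w : V} (h : G.Joins l v w) :
    v = G.fst l ∨ v = G.snd l := by
  rcases h with ⟨h1, -⟩ | ⟨-, h2⟩
  · exact Or.inl h1.symm
  · exact Or.inr h2.symm

/-- If `l` joins `v` and `w`, the ends of `l` are `v` and `w` (as an unordered pair). [cite: FeldmanSalmhoferTrubowitz1999, §2.1 p0005:L57-60] -/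
theorem Joins.fst_snd_cases {G : FGraph V L} {l : L} {v w : V} (h : G.Joins l v w) :
    (G.fst l = v ∧ G.snd l = w) ∨ (G.fst l = w ∧ G.snd l = v) := h

/-- Reachability is reflexive. [cite: FeldmanSalmhoferTrubowitz1999, §2.1 p0005:L57-60] -/
theorem reachable_self (S : Finset L) (v : V) : G.Reachable S v v :=
  Relation.ReflTransGen.refl

/-- Reachability is transitive. [cite: FeldmanSalmhoferTrubowitz1999, §2.1 p0005:L57-60] -/
theorem Reachable.trans {G : FGraph V L} {S : Finset L} {u v w : V} (h₁ : G.Reachable S u v)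
    (h₂ : G.Reachable S v w) : G.Reachable S u w :=
  Relation.ReflTransGen.trans h₁ h₂

/-- Extending a walk by one line. [cite: FeldmanSalmhoferTrubowitz1999, §2.1 p0005:L57-60] -/
theorem Reachable.tail {G : FGraph V L} {S : Finset L} {u v w : V} (h₁ : G.Reachable S u v)
    (h₂ : G.Adj S v w) : G.Reachable S u w :=
  Relation.ReflTransGen.tail h₁ h₂

/-- A single line of `S` joining `v` to `w` makes `w` reachable from `v`. [cite: FeldmanSalmhoferTrubowitz1999, §2.1 p0005:L57-60] -/
theorem reachable_of_joins {S : Finset L} {l : L} (hl : l ∈ S) {v w : V} (hj : G.Joins l v w) :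
    G.Reachable S v w :=
  Relation.ReflTransGen.single ⟨l, hl, hj⟩

/-- CLOSED SETS: if every line of `S` with an end satisfying `P` has both ends satisfying `P`,
then a walk over `S` starting in `P` stays in `P`. [cite: FeldmanSalmhoferTrubowitz1999, §2.1 p0005:L57-60] -/
theorem Reachable.mem_of_closed {G : FGraph V L} {S : Finset L} {P : V → Prop}
    (hP : ∀ l ∈ S, ∀ x y, G.Joins l x y → P x → P y) {v w : V} (h : G.Reachable S v w)
    (hv : P v) : P w := by
  unfold Reachable at h
  induction h with
  | refl => exact hv
  | tail _ hbc ih =>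
    obtain ⟨l, hl, hj⟩ := hbc
    exact hP l hl _ _ hj ih

/-- FIRST EXIT: a walk from inside `K` to outside `K` uses a line of `S` joining a vertex of `K`
to a vertex outside `K`. [cite: FeldmanSalmhoferTrubowitz1999, §2.1 p0005:L57-60] -/
theorem exists_joins_exit {S : Finset L} {K : Finset V} {v w : V} (h : G.Reachable S v w)
    (hv : v ∈ K) (hw : w ∉ K) : ∃ l ∈ S, ∃ x ∈ K, ∃ y ∉ K, G.Joins l x y := by
  by_contra hne
  exact hw (h.mem_of_closed (P := fun x => x ∈ K)
    (fun l hl x y hj hx => by_contra fun hy => hne ⟨l, hl, x, hx, y, hy, hj⟩) hv)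

/-! ### §2 Membership lemmas for the line sets of the statement file -/

section Members

variable [Fintype L] [DecidableEq V]

/-- Membership in `induced`. [cite: FeldmanSalmhoferTrubowitz1999, Lemma 2.5 (proof) p0005:L66-67] -/
@[simp] theorem mem_induced {W : Finset V} {l : L} :
    l ∈ G.induced W ↔ G.fst l ∈ W ∧ G.snd l ∈ W := by
  simp [induced]

/-- Membership in `linesBetween`. [cite: FeldmanSalmhoferTrubowitz1999, Lemma 2.5 (proof) p0005:L66-67] -/
@[simp] theorem mem_linesBetween {W₁ W₂ : Finset V} {l : L} :
    l ∈ G.linesBetween W₁ W₂ ↔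
      (G.fst l ∈ W₁ ∧ G.snd l ∈ W₂) ∨ (G.fst l ∈ W₂ ∧ G.snd l ∈ W₁) := by
  simp [linesBetween]

/-- A line of `linesBetween W₁ W₂` joins a vertex of `W₁` to a vertex of `W₂`. [cite: FeldmanSalmhoferTrubowitz1999, Lemma 2.5 (proof) p0005:L66-67] -/
theorem exists_joins_of_mem_linesBetween {W₁ W₂ : Finset V} {l : L}
    (hl : l ∈ G.linesBetween W₁ W₂) : ∃ x ∈ W₁, ∃ y ∈ W₂, G.Joins l x y := by
  rw [mem_linesBetween] at hl
  rcases hl with ⟨h1, h2⟩ | ⟨h1, h2⟩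
  · exact ⟨_, h1, _, h2, G.joins_fst_snd l⟩
  · exact ⟨_, h2, _, h1, (G.joins_fst_snd l).symm⟩

/-- A line joining a vertex of `W₁` to a vertex of `W₂` lies in `linesBetween W₁ W₂`. [cite: FeldmanSalmhoferTrubowitz1999, Lemma 2.5 (proof) p0005:L66-67] -/
theorem mem_linesBetween_of_joins {W₁ W₂ : Finset V} {l : L} {x y : V} (hj : G.Joins l x y)
    (hx : x ∈ W₁) (hy : y ∈ W₂) : l ∈ G.linesBetween W₁ W₂ := by
  rw [mem_linesBetween]
  rcases hj with ⟨h1, h2⟩ | ⟨h1, h2⟩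
  · exact Or.inl ⟨h1 ▸ hx, h2 ▸ hy⟩
  · exact Or.inr ⟨h1 ▸ hy, h2 ▸ hx⟩

/-- A line of `induced W` joining `x` to `y` has `y ∈ W`. [cite: FeldmanSalmhoferTrubowitz1999, Lemma 2.5 (proof) p0005:L66-67] -/
theorem mem_of_joins_of_mem_induced {W : Finset V} {l : L} (hl : l ∈ G.induced W) {x y : V}
    (hj : G.Joins l x y) : y ∈ W := by
  rw [mem_induced] at hl
  rcases hj with ⟨-, h2⟩ | ⟨h1, -⟩
  · exact h2 ▸ hl.2
  · exact h1 ▸ hl.1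

/-- A line with both ends in `W` lies in `induced W`. [cite: FeldmanSalmhoferTrubowitz1999, Lemma 2.5 (proof) p0005:L66-67] -/
theorem mem_induced_of_joins {W : Finset V} {l : L} {x y : V} (hj : G.Joins l x y) (hx : x ∈ W)
    (hy : y ∈ W) : l ∈ G.induced W := by
  rw [mem_induced]
  rcases hj with ⟨h1, h2⟩ | ⟨h1, h2⟩
  · exact ⟨h1 ▸ hx, h2 ▸ hy⟩
  · exact ⟨h1 ▸ hy, h2 ▸ hx⟩

/-- Walks over `induced W` starting in `W` stay in `W`. [cite: FeldmanSalmhoferTrubowitz1999, Lemma 2.5 (proof) p0005:L66-67] -/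
theorem Reachable.mem_of_induced {G : FGraph V L} {W : Finset V} {v w : V}
    (h : G.Reachable (G.induced W) v w) (hv : v ∈ W) : w ∈ W :=
  h.mem_of_closed (P := fun x => x ∈ W) (fun _ hl _ _ hj _ => G.mem_of_joins_of_mem_induced hl hj) hv

end Members

/-! ### §3 The boundary `∂A` of a vertex set; legs and parity -/

section Boundary

variable [Fintype V] [Fintype L] [DecidableEq V]

/-- The BOUNDARY `∂A = linesBetween A Aᶜ` of a vertex set `A`: the lines with exactly one end
in `A` (the lines "between `G₁` and `G'`", p0005:L103). [cite: FeldmanSalmhoferTrubowitz1999, Lemma 2.5 (proof) p0005:L92-107] -/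
theorem mem_bdry {A : Finset V} {l : L} :
    l ∈ G.linesBetween A Aᶜ ↔ (G.fst l ∈ A ∧ G.snd l ∉ A) ∨ (G.fst l ∉ A ∧ G.snd l ∈ A) := by
  simp [mem_linesBetween]

/-- A boundary line of `A` joins a vertex of `A` to a vertex outside `A`. [cite: FeldmanSalmhoferTrubowitz1999, Lemma 2.5 (proof) p0005:L100-107] -/
theorem exists_joins_of_mem_bdry {A : Finset V} {l : L} (hl : l ∈ G.linesBetween A Aᶜ) :
    ∃ x ∈ A, ∃ y ∉ A, G.Joins l x y := by
  rw [mem_bdry] at hl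
  rcases hl with ⟨h1, h2⟩ | ⟨h1, h2⟩
  · exact ⟨_, h1, _, h2, G.joins_fst_snd l⟩
  · exact ⟨_, h2, _, h1, (G.joins_fst_snd l).symm⟩

/-- A line joining a vertex of `A` to a vertex outside `A` is a boundary line. [cite: FeldmanSalmhoferTrubowitz1999, Lemma 2.5 (proof) p0005:L100-107] -/
theorem mem_bdry_of_joins {A : Finset V} {l : L} {x y : V} (hj : G.Joins l x y) (hx : x ∈ A)
    (hy : y ∉ A) : l ∈ G.linesBetween A Aᶜ := by
  rw [mem_bdry]
  rcases hj with ⟨h1, h2⟩ | ⟨h1, h2⟩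
  · exact Or.inl ⟨h1 ▸ hx, h2 ▸ hy⟩
  · exact Or.inr ⟨h1 ▸ hy, h2 ▸ hx⟩

/-- PARITY: under even incidence, `(external legs at A) + |∂A|` is even ("`G₁`, `G₂` and `G'`
must all have an even number of legs", p0005:L100-102).
[cite: FeldmanSalmhoferTrubowitz1999, Lemma 2.5 (proof) p0005:L100-104] -/
theorem even_extSum_add_card_bdry [DecidableEq L] (hev : G.EvenIncidence) (A : Finset V) :
    Even ((∑ v ∈ A, G.ext v) + (G.linesBetween A Aᶜ).card) := by
  rw [← G.subgraphLegs_induced]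
  exact even_subgraphLegs hev (G.isSubgraph_induced A)

/-- SKELETON: for a proper vertex set `A`, `(external legs at A) + |∂A| ≠ 2` (no proper two-legged
subgraph). [cite: FeldmanSalmhoferTrubowitz1999, §2 p0004:L31-32] -/
theorem extSum_add_card_bdry_ne_two [DecidableEq L] (hsk : G.IsSkeleton)
    {A : Finset V} (hA : A ≠ Finset.univ) : (∑ v ∈ A, G.ext v) + (G.linesBetween A Aᶜ).card ≠ 2 := by
  rw [← subgraphLegs_induced]
  exact hsk.2.2.2 A _ (G.isSubgraph_induced A) (Or.inl hA)

end Boundary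

section ExtLegs

/-- The external legs at a vertex set `A`: one for each of `a`, `b` lying in `A`. [cite: FeldmanSalmhoferTrubowitz1999, Lemma 2.5 (proof) p0005:L100-107] -/
theorem extSum_eq [Fintype V] [DecidableEq V] (h2 : G.IsTwoLegged) {a b : V} (ha : G.ext a = 1)
    (hb : G.ext b = 1) (hab : a ≠ b) (A : Finset V) :
    ∑ v ∈ A, G.ext v = (if a ∈ A then 1 else 0) + (if b ∈ A then 1 else 0) := by
  have hpt : ∀ v, G.ext v = (if a = v then 1 else 0) + (if b = v then 1 else 0) := by
    intro v
    by_cases hva : v = a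
    · subst hva; simp [ha, hab.symm]
    · by_cases hvb : v = b
      · subst hvb; simp [hb, hab]
      · rw [G.ext_eq_zero_of_ne h2 ha hb hab hva hvb]; simp [Ne.symm hva, Ne.symm hvb]
  simp_rw [hpt, Finset.sum_add_distrib, Finset.sum_ite_eq]

end ExtLegs

section Boundary2

variable [Fintype V] [Fintype L] [DecidableEq V]

/-- "`k₁ ≥ 3` and `k₂ ≥ 3`" (p0005:L103-106), in general form: every vertex set containing exactly
one of the two external vertices has an ODD number, at least THREE, of boundary lines (even
incidence makes `1 + |∂A|` even; the skeleton property forbids `1 + |∂A| = 2`).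
[cite: FeldmanSalmhoferTrubowitz1999, Lemma 2.5 (proof) p0005:L100-107] -/
theorem three_le_card_bdry [DecidableEq L] (hev : G.EvenIncidence)
    (h2 : G.IsTwoLegged) {a b : V} (ha : G.ext a = 1) (hb : G.ext b = 1) (hab : a ≠ b)
    (hsk : G.IsSkeleton) {A : Finset V} (haA : a ∈ A) (hbA : b ∉ A) :
    3 ≤ (G.linesBetween A Aᶜ).card ∧ Odd (G.linesBetween A Aᶜ).card := by
  have hA : A ≠ Finset.univ := fun h => hbA (h ▸ Finset.mem_univ b)
  have hsum : ∑ v ∈ A, G.ext v = 1 := by rw [G.extSum_eq h2 ha hb hab, if_pos haA, if_neg hbA]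
  have hev' := G.even_extSum_add_card_bdry hev A
  have hne := G.extSum_add_card_bdry_ne_two hsk hA
  rw [hsum] at hev' hne
  obtain ⟨k, hk⟩ := hev'
  exact ⟨by omega, ⟨k - 1, by omega⟩⟩

/-- A vertex set containing neither external vertex (and proper) has an EVEN number of boundary
lines, not equal to `2` ("`m_b + n_b` is even and `m_b + n_b ≥ 4`", p0005:L119-122, once it is
nonzero). [cite: FeldmanSalmhoferTrubowitz1999, Lemma 2.5 (proof) p0005:L115-122] -/
theorem even_card_bdry_of_not_mem [DecidableEq L] (hev : G.EvenIncidence)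
    (h2 : G.IsTwoLegged) {a b : V} (ha : G.ext a = 1) (hb : G.ext b = 1) (hab : a ≠ b)
    (hsk : G.IsSkeleton) {C : Finset V} (haC : a ∉ C) (hbC : b ∉ C) :
    Even (G.linesBetween C Cᶜ).card ∧ (G.linesBetween C Cᶜ).card ≠ 2 := by
  have hC : C ≠ Finset.univ := fun h => haC (h ▸ Finset.mem_univ a)
  have hsum : ∑ v ∈ C, G.ext v = 0 := by rw [G.extSum_eq h2 ha hb hab, if_neg haC, if_neg hbC]
  have hev' := G.even_extSum_add_card_bdry hev C
  have hne := G.extSum_add_card_bdry_ne_two hsk hC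
  rw [hsum, zero_add] at hev' hne
  exact ⟨hev', hne⟩

end Boundary2


/-! ### §4 Connecting line sets: monotonicity, hubs, restriction to a component -/

section Trees

/-- "The line set `S` connects the vertex set `W`" — every two vertices of `W` are joined by a
walk over lines of `S`, written out as `∀ v ∈ W, ∀ w ∈ W, G.Reachable S v w` throughout (so
`IsConnectedOn W` is this for `S = induced W`) — is monotone in `S`. [cite: FeldmanSalmhoferTrubowitz1999, §2.1 p0004:L44-47] -/
theorem connectsOn_mono {S S' : Finset L} (h : S ⊆ S') {W : Finset V}
    (hc : ∀ v ∈ W, ∀ w ∈ W, G.Reachable S v w) : ∀ v ∈ W, ∀ w ∈ W, G.Reachable S' v w :=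
  fun v hv w hw => (hc v hv w hw).mono h

/-- A line set connects `W` as soon as every vertex of `W` is reachable from one hub. [cite: FeldmanSalmhoferTrubowitz1999, §2.1 p0004:L44-47] -/
theorem connectsOn_of_hub {S : Finset L} {W : Finset V} {c : V} (h : ∀ w ∈ W, G.Reachable S c w) :
    (∀ v ∈ W, ∀ w ∈ W, G.Reachable S v w) :=
  fun v hv w hw => (h v hv).symm.trans (h w hw)

/-- RESTRICTION TO A COMPONENT: a walk from `c` over `S` only uses lines whose `fst` end is
reachable from `c`; so it is a walk over any `Sc` containing those lines. [cite: FeldmanSalmhoferTrubowitz1999, §2.1 p0004:L44-47] -/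
theorem reachable_filter_of_reachable {S : Finset L} {c w : V} (h : G.Reachable S c w)
    {Sc : Finset L} (hSc : ∀ l ∈ S, G.Reachable S c (G.fst l) → l ∈ Sc) : G.Reachable Sc c w := by
  unfold Reachable at h
  induction h with
  | refl => exact G.reachable_self _ _
  | @tail b d hcb hbd ih =>
    obtain ⟨l, hl, hj⟩ := hbd
    have hfst : G.Reachable S c (G.fst l) := by
      rcases hj.fst_snd_cases with ⟨h1, -⟩ | ⟨h1, -⟩
      · rw [h1]; exact hcb
      · rw [h1]; exact Relation.ReflTransGen.tail hcb ⟨l, hl, hj⟩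
    exact ih.tail ⟨l, hSc l hl hfst, hj⟩

end Trees


/-! ### §5 The three-block lemma (from the imported chain lemma) -/

section ThreeBlocks

/-- Two connected blocks joined by one line form a connected block. [cite: FeldmanSalmhoferTrubowitz1999, Lemma 2.5 (proof) p0006:L22-26] -/
theorem connectsOn_union_of_joins {S₁ S₂ S : Finset L} {W₁ W₂ : Finset V} [DecidableEq V]
    (h₁ : (∀ v ∈ W₁, ∀ w ∈ W₁, G.Reachable S₁ v w)) (h₂ : (∀ v ∈ W₂, ∀ w ∈ W₂, G.Reachable S₂ v w)) (hS₁ : S₁ ⊆ S) (hS₂ : S₂ ⊆ S)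
    {l : L} (hl : l ∈ S) {x y : V} (hj : G.Joins l x y) (hx : x ∈ W₁) (hy : y ∈ W₂) :
    (∀ v ∈ (W₁ ∪ W₂), ∀ w ∈ (W₁ ∪ W₂), G.Reachable S v w) := by
  refine G.connectsOn_of_hub (c := x) fun w hw => ?_
  rcases Finset.mem_union.1 hw with hw | hw
  · exact (h₁ x hx w hw).mono hS₁
  · exact (G.reachable_of_joins hl hj).trans ((h₂ y hy w hw).mono hS₂)

/-- THE THREE-BLOCK LEMMA. Let the vertex set be partitioned into three blocks `A`, `M`, `Z`, each
spanning a connected subgraph, with at least three boundary lines of `A` and at least three lines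
between `M` and `Z`. Then `G` is DOL. Derived from the imported chain lemma `isDOL_of_chain`
("the lines drawn fat are those in a possible spanning tree, where one can see directly from the
definition that the graph is DOL", p0006:L22-26): a boundary line `θ` of `A` goes to `M` or to `Z`,
and the chain `A | M | Z` resp. `A | Z | M` applies with two further boundary lines of `A` and the
three `M`–`Z` lines. [cite: FeldmanSalmhoferTrubowitz1999, Lemma 2.5 (proof) p0006:L22-26] -/
theorem isDOL_of_threeBlocks [Fintype V] [Fintype L] [DecidableEq V] [DecidableEq L]
    {A M Z : Finset V} (hAM : Disjoint A M) (hAZ : Disjoint A Z) (hMZ : Disjoint M Z)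
    (hcover : ∀ v, v ∈ A ∨ v ∈ M ∨ v ∈ Z)
    (hA : G.IsConnectedOn A) (hM : G.IsConnectedOn M) (hZ : G.IsConnectedOn Z)
    (h3A : 3 ≤ (G.linesBetween A Aᶜ).card) (h3MZ : 3 ≤ (G.linesBetween M Z).card) : G.IsDOL := by
  classical
  obtain ⟨θ, hθ⟩ : (G.linesBetween A Aᶜ).Nonempty := Finset.card_pos.1 (by omega)
  have h2A : 1 < ((G.linesBetween A Aᶜ).erase θ).card := by
    rw [Finset.card_erase_of_mem hθ]; omega
  obtain ⟨ℓ₁, hℓ₁, ℓ₂, hℓ₂, hℓ⟩ := Finset.one_lt_card.1 h2A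
  obtain ⟨ζ, hζ⟩ : (G.linesBetween M Z).Nonempty := Finset.card_pos.1 (by omega)
  have h2MZ : 1 < ((G.linesBetween M Z).erase ζ).card := by
    rw [Finset.card_erase_of_mem hζ]; omega
  obtain ⟨k₁, hk₁, k₂, hk₂, hk⟩ := Finset.one_lt_card.1 h2MZ
  obtain ⟨x, hx, y, hy, hj⟩ := G.exists_joins_of_mem_bdry hθ
  -- `θ` leaves `A` towards `M` or towards `Z`; in either case the imported chain lemma applies
  rcases hcover y with hyA | hyM | hyZ
  · exact absurd hyA hy
  · have hcoverU : A ∪ M ∪ Z = Finset.univ := by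
      ext v
      simp only [Finset.mem_union, Finset.mem_univ, iff_true]
      rcases hcover v with h | h | h
      · exact Or.inl (Or.inl h)
      · exact Or.inl (Or.inr h)
      · exact Or.inr h
    exact G.isDOL_of_chain hAM hAZ hMZ hcoverU hA hM hZ (G.mem_linesBetween_of_joins hj hx hyM)
      (Finset.mem_of_mem_erase hℓ₁) (Finset.mem_of_mem_erase hℓ₂) hℓ (Finset.ne_of_mem_erase hℓ₁)
      (Finset.ne_of_mem_erase hℓ₂) hζ (Finset.mem_of_mem_erase hk₁) (Finset.mem_of_mem_erase hk₂)
      hk (Finset.ne_of_mem_erase hk₁) (Finset.ne_of_mem_erase hk₂)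
  · have hcoverU : A ∪ Z ∪ M = Finset.univ := by
      ext v
      simp only [Finset.mem_union, Finset.mem_univ, iff_true]
      rcases hcover v with h | h | h
      · exact Or.inl (Or.inl h)
      · exact Or.inr h
      · exact Or.inl (Or.inr h)
    have hsw : G.linesBetween M Z = G.linesBetween Z M := G.linesBetween_comm M Z
    exact G.isDOL_of_chain hAZ hAM hMZ.symm hcoverU hA hZ hM (G.mem_linesBetween_of_joins hj hx hyZ)
      (Finset.mem_of_mem_erase hℓ₁) (Finset.mem_of_mem_erase hℓ₂) hℓ (Finset.ne_of_mem_erase hℓ₁)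
      (Finset.ne_of_mem_erase hℓ₂) (hsw ▸ hζ) (hsw ▸ Finset.mem_of_mem_erase hk₁)
      (hsw ▸ Finset.mem_of_mem_erase hk₂) hk (Finset.ne_of_mem_erase hk₁)
      (Finset.ne_of_mem_erase hk₂)

end ThreeBlocks


/-! ### §6 Connected components of `G - {a, b}` (the components `C_α` of `G'`, p0005:L108-113) -/

section Components

variable [Fintype V] [Fintype L] [DecidableEq V]

omit [Fintype V] in
/-- A component (the vertices reachable from `c ∈ W` inside the subgraph spanned by `W`) lies in
`W`. [cite: FeldmanSalmhoferTrubowitz1999, Lemma 2.5 (proof) p0005:L108-113] -/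
theorem comp_subset {W K : Finset V} {c : V} (hc : c ∈ W)
    (hK : ∀ x, x ∈ K ↔ G.Reachable (G.induced W) c x) : K ⊆ W :=
  fun x hx => ((hK x).1 hx).mem_of_induced hc

omit [Fintype V] in
/-- `c` lies in its component. [cite: FeldmanSalmhoferTrubowitz1999, Lemma 2.5 (proof) p0005:L108-113] -/
theorem mem_comp_self {W K : Finset V} {c : V} (hK : ∀ x, x ∈ K ↔ G.Reachable (G.induced W) c x) :
    c ∈ K :=
  (hK c).2 (G.reachable_self _ _)

omit [Fintype V] in
/-- Components are closed under adjacency inside `W`. [cite: FeldmanSalmhoferTrubowitz1999, Lemma 2.5 (proof) p0005:L108-113] -/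
theorem comp_mem_of_joins {W K : Finset V} {c : V} (hc : c ∈ W)
    (hK : ∀ x, x ∈ K ↔ G.Reachable (G.induced W) c x) {x y : V} {l : L} (hx : x ∈ K)
    (hj : G.Joins l x y) (hy : y ∈ W) : y ∈ K :=
  (hK y).2 (((hK x).1 hx).tail ⟨l, G.mem_induced_of_joins hj (G.comp_subset hc hK hx) hy, hj⟩)

omit [Fintype V] in
/-- A component spans a connected subgraph ("decompose it into its connected components `C_α`",
p0005:L108-109). [cite: FeldmanSalmhoferTrubowitz1999, Lemma 2.5 (proof) p0005:L108-113] -/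
theorem isConnectedOn_of_comp {W K : Finset V} {c : V} (hc : c ∈ W)
    (hK : ∀ x, x ∈ K ↔ G.Reachable (G.induced W) c x) : G.IsConnectedOn K := by
  change (∀ v ∈ K, ∀ w ∈ K, G.Reachable (G.induced K) v w)
  refine G.connectsOn_of_hub (c := c) fun w hw => ?_
  have hKW := G.comp_subset hc hK
  exact G.reachable_filter_of_reachable ((hK w).1 hw) fun l hl hr =>
    G.mem_induced_of_joins (G.joins_fst_snd l) ((hK _).2 hr)
      ((hK _).2 (hr.tail ⟨l, hl, G.joins_fst_snd l⟩))

omit [Fintype V] in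
/-- Two components sharing a vertex coincide. [cite: FeldmanSalmhoferTrubowitz1999, Lemma 2.5 (proof) p0005:L108-113] -/
theorem comp_eq_comp_of_mem {W K K' : Finset V} {c c' : V}
    (hK : ∀ x, x ∈ K ↔ G.Reachable (G.induced W) c x)
    (hK' : ∀ x, x ∈ K' ↔ G.Reachable (G.induced W) c' x) {x : V} (hx : x ∈ K) (hx' : x ∈ K') :
    K = K' := by
  ext y
  rw [hK, hK']
  have hcx := (hK x).1 hx
  have hc'x := (hK' x).1 hx'
  exact ⟨fun h => hc'x.trans (hcx.symm.trans h), fun h => hcx.trans (hc'x.symm.trans h)⟩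

/-- A boundary line of a component leaves `W` ("The connected components of `D` may be joined only
to `v₀`, only to `v₁`, or to `v₀` and `v₁`", p0006:L48-50).
[cite: FeldmanSalmhoferTrubowitz1999, §2.2 p0006:L48-50] -/
theorem exists_joins_of_mem_bdry_comp {W K : Finset V} {c : V} (hc : c ∈ W)
    (hK : ∀ x, x ∈ K ↔ G.Reachable (G.induced W) c x) {l : L} (hl : l ∈ G.linesBetween K Kᶜ) :
    ∃ x ∈ K, ∃ y ∉ W, G.Joins l x y := by
  obtain ⟨x, hx, y, hy, hj⟩ := G.exists_joins_of_mem_bdry hl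
  exact ⟨x, hx, y, fun hyW => hy (G.comp_mem_of_joins hc hK hx hj hyW), hj⟩

omit [Fintype V] in
/-- A line between `K` and `{p}` joins a vertex of `K` to `p`. [cite: FeldmanSalmhoferTrubowitz1999, Lemma 2.5 (proof) p0005:L108-113] -/
theorem exists_joins_of_mem_linesBetween_singleton {K : Finset V} {p : V} {l : L}
    (hl : l ∈ G.linesBetween K {p}) : ∃ x ∈ K, G.Joins l x p := by
  obtain ⟨x, hx, y, hy, hj⟩ := G.exists_joins_of_mem_linesBetween hl
  rw [Finset.mem_singleton] at hy
  exact ⟨x, hx, hy ▸ hj⟩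

/-- A boundary line of `{p}` joins `p` to another vertex. [cite: FeldmanSalmhoferTrubowitz1999, Lemma 2.5 (proof) p0005:L108-113] -/
theorem exists_joins_of_mem_bdry_singleton {p : V} {l : L} (hl : l ∈ G.linesBetween {p} {p}ᶜ) :
    ∃ y, y ≠ p ∧ G.Joins l p y := by
  obtain ⟨x, hx, y, hy, hj⟩ := G.exists_joins_of_mem_bdry hl
  rw [Finset.mem_singleton] at hx hy
  exact ⟨y, hy, hx ▸ hj⟩

omit [Fintype V] in
/-- In a connected graph every component of `G - {p, q}` is attached to `p` or to `q` ("There is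
at least one component of `G'` that connects to both …", p0005:L113-114, in the form needed).
[cite: FeldmanSalmhoferTrubowitz1999, Lemma 2.5 (proof) p0005:L108-114] -/
theorem comp_attached (hGc : G.IsConnected) {p q : V} {W : Finset V}
    (hW : ∀ x, x ∈ W ↔ x ≠ p ∧ x ≠ q) {c : V} (hc : c ∈ W) {K : Finset V}
    (hK : ∀ x, x ∈ K ↔ G.Reachable (G.induced W) c x) :
    (G.linesBetween K {p}).Nonempty ∨ (G.linesBetween K {q}).Nonempty := by
  have hpK : p ∉ K := fun h => ((hW p).1 (G.comp_subset hc hK h)).1 rfl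
  obtain ⟨l, -, x, hx, y, hy, hj⟩ := G.exists_joins_exit (hGc c p) (G.mem_comp_self hK) hpK
  have hyW : y ∉ W := fun hyW => hy (G.comp_mem_of_joins hc hK hx hj hyW)
  rw [hW, not_and_or, not_not, not_not] at hyW
  rcases hyW with rfl | rfl
  · exact Or.inl ⟨l, G.mem_linesBetween_of_joins hj hx (Finset.mem_singleton_self _)⟩
  · exact Or.inr ⟨l, G.mem_linesBetween_of_joins hj hx (Finset.mem_singleton_self _)⟩

/-- The boundary of a component of `G - {p, q}` consists of its lines to `p` and its lines to `q`,
and these are different lines (`p ≠ q`): "`m_b`" and "`n_b`" of Figure 6.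
[cite: FeldmanSalmhoferTrubowitz1999, Lemma 2.5 (proof) p0005:L115-122] -/
theorem card_bdry_comp [DecidableEq L] {p q : V} (hpq : p ≠ q) {W : Finset V}
    (hW : ∀ x, x ∈ W ↔ x ≠ p ∧ x ≠ q) {c : V} (hc : c ∈ W) {K : Finset V}
    (hK : ∀ x, x ∈ K ↔ G.Reachable (G.induced W) c x) :
    (G.linesBetween K Kᶜ).card = (G.linesBetween K {p}).card + (G.linesBetween K {q}).card := by
  have hKW := G.comp_subset hc hK
  have hpK : p ∉ K := fun h => ((hW p).1 (hKW h)).1 rfl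
  have hqK : q ∉ K := fun h => ((hW q).1 (hKW h)).2 rfl
  rw [← Finset.card_union_of_disjoint]
  · congr 1
    ext l
    rw [Finset.mem_union]
    constructor
    · intro hl
      obtain ⟨x, hx, y, hy, hj⟩ := G.exists_joins_of_mem_bdry_comp hc hK hl
      rw [hW, not_and_or, not_not, not_not] at hy
      rcases hy with rfl | rfl
      · exact Or.inl (G.mem_linesBetween_of_joins hj hx (Finset.mem_singleton_self _))
      · exact Or.inr (G.mem_linesBetween_of_joins hj hx (Finset.mem_singleton_self _))
    · rintro (hl | hl)
      · obtain ⟨x, hx, hj⟩ := G.exists_joins_of_mem_linesBetween_singleton hl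
        exact G.mem_bdry_of_joins hj hx hpK
      · obtain ⟨x, hx, hj⟩ := G.exists_joins_of_mem_linesBetween_singleton hl
        exact G.mem_bdry_of_joins hj hx hqK
  · rw [Finset.disjoint_left]
    intro l hlp hlq
    obtain ⟨x, hx, hj⟩ := G.exists_joins_of_mem_linesBetween_singleton hlp
    obtain ⟨x', hx', hj'⟩ := G.exists_joins_of_mem_linesBetween_singleton hlq
    have hxp : x ≠ q := ((hW x).1 (hKW hx)).2
    have hx'p : x' ≠ p := ((hW x').1 (hKW hx')).1
    rcases hj with ⟨h1, h2⟩ | ⟨h1, h2⟩ <;> rcases hj' with ⟨h3, h4⟩ | ⟨h3, h4⟩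
    · exact hpq (h2.symm.trans h4)
    · exact hxp (h1.symm.trans h3)
    · exact hx'p (h3.symm.trans h1)
    · exact hpq (h1.symm.trans h3)

omit [Fintype V] in
/-- The block "`p` together with the components (other than `K`) selected by `P`" spans a
connected subgraph, provided every selected component is attached to `p` ("All components that
connect only to `v₀` are absorbed in a connected subgraph `G₁` of `G`", p0006:L50-52; "We absorb all
these components in `G₁`", p0005:L111-112).
[cite: FeldmanSalmhoferTrubowitz1999, Lemma 2.5 (proof) p0005:L108-113] -/
theorem isConnectedOn_block {W : Finset V} {comp : V → Finset V}
    (hcomp : ∀ v x, x ∈ comp v ↔ G.Reachable (G.induced W) v x)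
    {K : Finset V} {c : V} (hK : ∀ x, x ∈ K ↔ G.Reachable (G.induced W) c x)
    {p : V} {P : Finset V → Prop} (hP : ∀ v ∈ W, P (comp v) → (G.linesBetween (comp v) {p}).Nonempty)
    {B : Finset V} (hB : ∀ x, x ∈ B ↔ x = p ∨ (x ∈ W ∧ x ∉ K ∧ P (comp x))) :
    G.IsConnectedOn B := by
  have hpB : p ∈ B := (hB p).2 (Or.inl rfl)
  change (∀ v ∈ B, ∀ w ∈ B, G.Reachable (G.induced B) v w)
  refine G.connectsOn_of_hub (c := p) fun w hw => ?_
  rcases (hB w).1 hw with rfl | ⟨hwW, hwK, hPw⟩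
  · exact G.reachable_self _ _
  · obtain ⟨l, hl⟩ := hP w hwW hPw
    obtain ⟨x, hx, hj⟩ := G.exists_joins_of_mem_linesBetween_singleton hl
    have hsub : comp w ⊆ B := by
      intro z hz
      have hzW : z ∈ W := G.comp_subset hwW (hcomp w) hz
      have hcz : comp z = comp w :=
        G.comp_eq_comp_of_mem (hcomp z) (hcomp w) (G.mem_comp_self (hcomp z)) hz
      have hzK : z ∉ K := fun hzK =>
        hwK ((G.comp_eq_comp_of_mem (hcomp w) hK hz hzK) ▸ G.mem_comp_self (hcomp w))
      exact (hB z).2 (Or.inr ⟨hzW, hzK, hcz ▸ hPw⟩)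
    have h1 : G.Reachable (G.induced B) w x :=
      ((G.isConnectedOn_of_comp hwW (hcomp w)) w (G.mem_comp_self (hcomp w)) x hx).mono
        (G.induced_mono hsub)
    have h2 : G.Reachable (G.induced B) x p :=
      G.reachable_of_joins (G.mem_induced_of_joins hj (hsub hx) hpB) hj
    exact (h1.trans h2).symm

end Components

/-! ### §7 A component with three lines to one external vertex -/

/-- From `t ≥ 2`: no line joins `a` to `b` (else `t ≤ 1`).
[cite: FeldmanSalmhoferTrubowitz1999, §2.1 p0005:L29-37] -/
theorem not_joins_of_two_le_edist [Fintype V] [Fintype L] [DecidableEq V] {a b : V}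
    (ht : 2 ≤ G.edist a b) (l : L) : ¬ G.Joins l a b := fun hl =>
  G.not_mem_ball_of_lt_edist (show 1 < G.edist a b by omega)
    (G.mem_ball_succ_of_joins (G.mem_ball_self a 0) hl)

section Assembly

variable [Fintype V] [Fintype L] [DecidableEq V] [DecidableEq L]

/-- ONE COMPONENT WITH THREE LINES TO `q` GIVES DOL. `p`, `q` are the two external vertices, `K` a
component of `G - {p, q}` joined to `q` by at least three lines. Blocks: `A = p ∪` (components
`≠ K` attached to `p`), `M = K`, `Z = q ∪` (the remaining components, all attached to `q`); then
`|∂A| ≥ 3` by parity and the three-block lemma applies. This is Figure 7 (`m₁ = 1`, `n₁ ≥ 3`) and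
Figure 8 (`m₁ ≥ 3`) of the print with the roles of `v₀`, `v_t` as needed.
[cite: FeldmanSalmhoferTrubowitz1999, Lemma 2.5 (proof) p0006:L9-26] -/
theorem isDOL_of_comp (hev : G.EvenIncidence) (h2 : G.IsTwoLegged) {p q : V} (hp : G.ext p = 1)
    (hq : G.ext q = 1) (hpq : p ≠ q) (hsk : G.IsSkeleton) {W : Finset V}
    (hW : ∀ x, x ∈ W ↔ x ≠ p ∧ x ≠ q) {c : V} (hc : c ∈ W) {K : Finset V}
    (hK : ∀ x, x ∈ K ↔ G.Reachable (G.induced W) c x) (h3 : 3 ≤ (G.linesBetween K {q}).card) :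
    G.IsDOL := by
  classical
  have hGc : G.IsConnected := hsk.1
  set comp : V → Finset V := fun v => Finset.univ.filter (fun x => G.Reachable (G.induced W) v x)
    with hcomp_def
  have hcomp : ∀ v x, x ∈ comp v ↔ G.Reachable (G.induced W) v x := fun v x => by simp [hcomp_def]
  have hKW : K ⊆ W := G.comp_subset hc hK
  have hpW : p ∉ W := fun h => ((hW p).1 h).1 rfl
  have hqW : q ∉ W := fun h => ((hW q).1 h).2 rfl
  have hpK : p ∉ K := fun h => hpW (hKW h)
  have hqK : q ∉ K := fun h => hqW (hKW h)
  set A := insert p (W.filter fun v => v ∉ K ∧ (G.linesBetween (comp v) {p}).Nonempty) with hA_def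
  set Z := insert q (W.filter fun v => v ∉ K ∧ ¬ (G.linesBetween (comp v) {p}).Nonempty)
    with hZ_def
  have hA : ∀ x, x ∈ A ↔ x = p ∨ (x ∈ W ∧ x ∉ K ∧ (G.linesBetween (comp x) {p}).Nonempty) :=
    fun x => by simp only [hA_def, Finset.mem_insert, Finset.mem_filter]
  have hZ : ∀ x, x ∈ Z ↔ x = q ∨ (x ∈ W ∧ x ∉ K ∧ ¬ (G.linesBetween (comp x) {p}).Nonempty) :=
    fun x => by simp only [hZ_def, Finset.mem_insert, Finset.mem_filter]
  have hpA : p ∈ A := (hA p).2 (Or.inl rfl)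
  have hqZ : q ∈ Z := (hZ q).2 (Or.inl rfl)
  have hqA : q ∉ A := fun h => by
    rcases (hA q).1 h with h | ⟨h, -⟩
    · exact hpq h.symm
    · exact hqW h
  -- the partition
  have hAK : Disjoint A K := Finset.disjoint_left.2 fun x hxA hxK => by
    rcases (hA x).1 hxA with rfl | ⟨-, hxK', -⟩
    · exact hpK hxK
    · exact hxK' hxK
  have hKZ : Disjoint K Z := Finset.disjoint_left.2 fun x hxK hxZ => by
    rcases (hZ x).1 hxZ with rfl | ⟨-, hxK', -⟩
    · exact hqK hxK
    · exact hxK' hxK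
  have hAZ : Disjoint A Z := Finset.disjoint_left.2 fun x hxA hxZ => by
    rcases (hA x).1 hxA with rfl | ⟨hxW, -, hatt⟩ <;> rcases (hZ x).1 hxZ with h | ⟨hxW', -, hatt'⟩
    · exact hpq h
    · exact hpW hxW'
    · exact hqW (h ▸ hxW)
    · exact hatt' hatt
  have hcover : ∀ v, v ∈ A ∨ v ∈ K ∨ v ∈ Z := by
    intro v
    by_cases hvp : v = p
    · exact Or.inl ((hA v).2 (Or.inl hvp))
    by_cases hvq : v = q
    · exact Or.inr (Or.inr ((hZ v).2 (Or.inl hvq)))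
    have hvW : v ∈ W := (hW v).2 ⟨hvp, hvq⟩
    by_cases hvK : v ∈ K
    · exact Or.inr (Or.inl hvK)
    by_cases hatt : (G.linesBetween (comp v) {p}).Nonempty
    · exact Or.inl ((hA v).2 (Or.inr ⟨hvW, hvK, hatt⟩))
    · exact Or.inr (Or.inr ((hZ v).2 (Or.inr ⟨hvW, hvK, hatt⟩)))
  -- connectivity of the blocks
  have hAconn : G.IsConnectedOn A :=
    G.isConnectedOn_block hcomp hK (P := fun C => (G.linesBetween C {p}).Nonempty)
      (fun _ _ h => h) hA
  have hZconn : G.IsConnectedOn Z :=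
    G.isConnectedOn_block hcomp hK (P := fun C => ¬ (G.linesBetween C {p}).Nonempty)
      (fun v hv h => (G.comp_attached hGc hW hv (hcomp v)).resolve_left h) hZ
  have hKconn : G.IsConnectedOn K := G.isConnectedOn_of_comp hc hK
  -- the two counts
  have h3A : 3 ≤ (G.linesBetween A Aᶜ).card := (G.three_le_card_bdry hev h2 hp hq hpq hsk hpA hqA).1
  have h3KZ : 3 ≤ (G.linesBetween K Z).card :=
    h3.trans (Finset.card_le_card (G.linesBetween_mono_right K (Finset.singleton_subset_iff.2 hqZ)))
  exact G.isDOL_of_threeBlocks hAK hAZ hKZ hcover hAconn hKconn hZconn h3A h3KZ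

end Assembly


/-! ### §8 Tools for Theorem 2.6: line counts, small blocks, separating two vertices of a block -/

section Tools26

variable [Fintype L] [DecidableEq V]

/-- `lineCount u v` is the number of lines between `{u}` and `{v}`.
[cite: FeldmanSalmhoferTrubowitz1999, §2.2 p0006:L44-46] -/
theorem lineCount_eq_card_linesBetween (u v : V) :
    G.lineCount u v = (G.linesBetween {u} {v}).card := by
  unfold lineCount
  congr 1
  ext l
  simp only [Finset.mem_filter, Finset.mem_univ, true_and, mem_linesBetween, Finset.mem_singleton]

/-- `lineCount` is symmetric. [cite: FeldmanSalmhoferTrubowitz1999, §2.2 p0006:L44-46] -/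
theorem lineCount_comm (u v : V) : G.lineCount u v = G.lineCount v u := by
  unfold lineCount
  congr 1
  ext l
  simp only [Finset.mem_filter, Finset.mem_univ, true_and]
  exact ⟨Joins.symm, Joins.symm⟩

/-- A single vertex spans a connected subgraph. [cite: FeldmanSalmhoferTrubowitz1999, Lemma 2.5 (proof) p0005:L68-69] -/
theorem isConnectedOn_singleton (x : V) : G.IsConnectedOn {x} := by
  intro v hv w hw
  rw [Finset.mem_singleton] at hv hw
  rw [hv, hw]
  exact G.reachable_self _ _

/-- Adding a vertex joined by a line to a connected block keeps it connected.
[cite: FeldmanSalmhoferTrubowitz1999, Lemma 2.5 (proof) p0005:L108-113] -/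
theorem isConnectedOn_insert_of_joins {P : Finset V} (hP : G.IsConnectedOn P) {u v : V} (hu : u ∈ P)
    {l : L} (hj : G.Joins l u v) : G.IsConnectedOn (insert v P) := by
  change ∀ x ∈ insert v P, ∀ y ∈ insert v P, G.Reachable (G.induced (insert v P)) x y
  refine G.connectsOn_of_hub (c := u) fun w hw => ?_
  rcases Finset.mem_insert.1 hw with rfl | hw
  · exact G.reachable_of_joins
      (G.mem_induced_of_joins hj (Finset.mem_insert_of_mem hu) (Finset.mem_insert_self _ _)) hj
  · exact (hP u hu w hw).mono (G.induced_mono (Finset.subset_insert _ _))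

/-- SEPARATION: two distinct vertices `v ≠ v'` of a connected block `J` are separated by a partition
of `J` into two connected blocks `X ∋ v`, `Y ∋ v'` (`X` = the component of `v` in `J - v'`; every
other component of `J - v'` hangs off `v'`). [cite: FeldmanSalmhoferTrubowitz1999, §2.2 p0006:L48-55] -/
theorem exists_separation [Fintype V] {J : Finset V} (hJ : G.IsConnectedOn J) {v v' : V}
    (hv : v ∈ J) (hv' : v' ∈ J) (hne : v ≠ v') :
    ∃ X Y : Finset V, Disjoint X Y ∧ X ∪ Y = J ∧ v ∈ X ∧ v' ∈ Y ∧
      G.IsConnectedOn X ∧ G.IsConnectedOn Y := by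
  classical
  set W := J.erase v' with hW_def
  have hvW : v ∈ W := Finset.mem_erase.2 ⟨hne, hv⟩
  set comp : V → Finset V := fun c => Finset.univ.filter (fun x => G.Reachable (G.induced W) c x)
    with hcomp_def
  have hcomp : ∀ c x, x ∈ comp c ↔ G.Reachable (G.induced W) c x := fun c x => by simp [hcomp_def]
  set X := comp v with hX_def
  set Y := J \ X with hY_def
  have hXW : X ⊆ W := G.comp_subset hvW (hcomp v)
  have hXJ : X ⊆ J := hXW.trans (Finset.erase_subset _ _)
  have hv'X : v' ∉ X := fun h => (Finset.mem_erase.1 (hXW h)).1 rfl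
  refine ⟨X, Y, Finset.disjoint_sdiff, Finset.union_sdiff_of_subset hXJ, G.mem_comp_self (hcomp v),
    Finset.mem_sdiff.2 ⟨hv', hv'X⟩, G.isConnectedOn_of_comp hvW (hcomp v), ?_⟩
  -- `Y` is connected with hub `v'`
  change ∀ x ∈ Y, ∀ y ∈ Y, G.Reachable (G.induced Y) x y
  refine G.connectsOn_of_hub (c := v') fun y hy => ?_
  obtain ⟨hyJ, hyX⟩ := Finset.mem_sdiff.1 hy
  by_cases hyv' : y = v'
  · rw [hyv']; exact G.reachable_self _ _
  have hyW : y ∈ W := Finset.mem_erase.2 ⟨hyv', hyJ⟩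
  -- the component of `y` in `J - v'` lies in `Y` and is left, inside `J`, only towards `v'`
  have hsubY : comp y ⊆ Y := by
    intro z hz
    refine Finset.mem_sdiff.2 ⟨Finset.erase_subset _ _ (G.comp_subset hyW (hcomp y) hz), fun hzX => ?_⟩
    refine hyX ?_
    rw [hX_def, ← G.comp_eq_comp_of_mem (hcomp y) (hcomp v) hz hzX]
    exact G.mem_comp_self (hcomp y)
  have hvy : v ∉ comp y := by
    intro h
    refine hyX ?_
    rw [hX_def, G.comp_eq_comp_of_mem (hcomp v) (hcomp y) (G.mem_comp_self (hcomp v)) h]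
    exact G.mem_comp_self (hcomp y)
  obtain ⟨l, hl, x, hx, z, hz, hj⟩ :=
    G.exists_joins_exit (hJ y hyJ v hv) (G.mem_comp_self (hcomp y)) hvy
  have hzJ : z ∈ J := G.mem_of_joins_of_mem_induced hl hj
  have hzv' : z = v' := by
    by_contra hzv'
    exact hz (G.comp_mem_of_joins hyW (hcomp y) hx hj (Finset.mem_erase.2 ⟨hzv', hzJ⟩))
  have hv'Y : v' ∈ Y := Finset.mem_sdiff.2 ⟨hv', hv'X⟩
  have hzY : z ∈ Y := hzv' ▸ hv'Y
  have h1 : G.Reachable (G.induced Y) y x :=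
    ((G.isConnectedOn_of_comp hyW (hcomp y)) y (G.mem_comp_self (hcomp y)) x hx).mono
      (G.induced_mono hsubY)
  have h2 : G.Reachable (G.induced Y) x z :=
    G.reachable_of_joins (G.mem_induced_of_joins hj (hsubY hx) hzY) hj
  rw [← hzv']
  exact (h1.trans h2).symm

end Tools26


/-! ### §9 Theorem 2.6, first reductions: `t = 1`, and the components of `G - {a, b}` under `¬DOL` -/

section Thm26Reductions

variable [Fintype V] [Fintype L] [DecidableEq V] [DecidableEq L]

omit [DecidableEq L] in
/-- A walk from `v` to `w` puts `w` in some ball about `v`.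
[cite: FeldmanSalmhoferTrubowitz1999, Lemma 2.5 (proof) p0005:L57-60] -/
theorem exists_mem_ball_of_reachable {v w : V} (h : G.Reachable Finset.univ v w) :
    ∃ n, w ∈ G.ball v n := by
  unfold Reachable at h
  induction h with
  | refl => exact ⟨0, G.mem_ball_self v 0⟩
  | @tail b c _ hbc ih =>
    obtain ⟨n, hn⟩ := ih
    obtain ⟨l, -, hj⟩ := hbc
    exact ⟨n + 1, G.mem_ball_succ_of_joins hn hj⟩

/-- **`t = 1`**: a non-DOL two-legged skeleton graph with distinct external vertices has them ADJACENT
("To complete the classification of doubly overlapping graphs, we turn to the case `t = 1`",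
p0006:L41-42): `t ≥ 2` would make it DOL by Theorem 2.4 (`theorem24_holds`), and `t = 0` means
`a = b`. [cite: FeldmanSalmhoferTrubowitz1999, §2.2 p0006:L41-44] -/
theorem exists_joins_of_not_isDOL (hev : G.EvenIncidence) (h2 : G.IsTwoLegged) {a b : V}
    (ha : G.ext a = 1) (hb : G.ext b = 1) (hab : a ≠ b) (hsk : G.IsSkeleton) (hndol : ¬ G.IsDOL) :
    ∃ l : L, G.Joins l a b := by
  by_contra hno
  refine hndol (G.isDOL_of_two_le_edist hev h2 ha hb hsk ?_)
  obtain ⟨n, hn⟩ := G.exists_mem_ball_of_reachable (hsk.1 a b)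
  have hmem : b ∈ G.ball a (G.edist a b) := G.mem_ball_edist ⟨n, hn⟩
  by_contra hlt
  have h01 : G.edist a b = 0 ∨ G.edist a b = 0 + 1 := by omega
  rcases h01 with h0 | h1
  · rw [h0, G.ball_zero, Finset.mem_singleton] at hmem
    exact hab hmem.symm
  · rw [h1, G.mem_ball_succ_iff, G.ball_zero] at hmem
    rcases hmem with h | ⟨u, hu, l, hj⟩
    · exact hab (Finset.mem_singleton.1 h).symm
    · rw [Finset.mem_singleton] at hu
      exact hno ⟨l, hu ▸ hj⟩

omit [Fintype V] [DecidableEq L] in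
/-- `linesBetween` is monotone in its first argument. [cite: FeldmanSalmhoferTrubowitz1999, Lemma 2.5 (proof) p0005:L92-95] -/
theorem linesBetween_mono_left {A A' : Finset V} (h : A ⊆ A') (B : Finset V) :
    G.linesBetween A B ⊆ G.linesBetween A' B := by
  rw [G.linesBetween_comm A B, G.linesBetween_comm A' B]
  exact G.linesBetween_mono_right B h

omit [Fintype V] [DecidableEq L] in
/-- Block connectivity with a connected BASE block `B₀` (instead of a single vertex): `B₀` together
with the components (of the subgraph spanned by `S`) selected by `P` spans a connected subgraph as soon
as every selected component is joined to `B₀` by a line ("we absorb all these components in `G₁`",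
p0005:L111-112). [cite: FeldmanSalmhoferTrubowitz1999, Lemma 2.5 (proof) p0005:L108-113] -/
theorem isConnectedOn_blockBase {S : Finset V} {comp : V → Finset V}
    (hcomp : ∀ v x, x ∈ comp v ↔ G.Reachable (G.induced S) v x)
    {B₀ : Finset V} (hB₀ : G.IsConnectedOn B₀) {b₀ : V} (hb₀ : b₀ ∈ B₀)
    {P : Finset V → Prop} (hP : ∀ v ∈ S, P (comp v) → (G.linesBetween (comp v) B₀).Nonempty)
    {B : Finset V} (hB : ∀ x, x ∈ B ↔ x ∈ B₀ ∨ (x ∈ S ∧ P (comp x))) : G.IsConnectedOn B := by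
  have hB₀B : B₀ ⊆ B := fun x hx => (hB x).2 (Or.inl hx)
  change ∀ x ∈ B, ∀ y ∈ B, G.Reachable (G.induced B) x y
  refine G.connectsOn_of_hub (c := b₀) fun w hw => ?_
  rcases (hB w).1 hw with hw₀ | ⟨hwS, hPw⟩
  · exact (hB₀ b₀ hb₀ w hw₀).mono (G.induced_mono hB₀B)
  · obtain ⟨l, hl⟩ := hP w hwS hPw
    obtain ⟨x, hx, z, hz, hj⟩ := G.exists_joins_of_mem_linesBetween hl
    have hsub : comp w ⊆ B := by
      intro y hy
      have hyS : y ∈ S := G.comp_subset hwS (hcomp w) hy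
      have hcy : comp y = comp w :=
        G.comp_eq_comp_of_mem (hcomp y) (hcomp w) (G.mem_comp_self (hcomp y)) hy
      exact (hB y).2 (Or.inr ⟨hyS, hcy ▸ hPw⟩)
    have h1 : G.Reachable (G.induced B) w x :=
      ((G.isConnectedOn_of_comp hwS (hcomp w)) w (G.mem_comp_self (hcomp w)) x hx).mono
        (G.induced_mono hsub)
    have h2 : G.Reachable (G.induced B) x z :=
      G.reachable_of_joins (G.mem_induced_of_joins hj (hsub hx) (hB₀B hz)) hj
    have h3 : G.Reachable (G.induced B) z b₀ := (hB₀ z hz b₀ hb₀).mono (G.induced_mono hB₀B)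
    exact (h1.trans (h2.trans h3)).symm

/-- **A one-sided component makes `G` DOL** ("If `D` is nonempty and `G₁` has at least one vertex in
addition to `v₀`, then, by the definition of skeleton graphs, `G₁` is overlapping and hence `G` is
DOL", p0006:L53-55 — here by the three-block lemma): if a component `K` of `G - {p, q}` is joined to
`p` only, the blocks `q ∪` (components attached to `q`), `K`, `p ∪` (the other components) carry
`|∂(q-block)| ≥ 3` and `|∂K| ≥ 4` lines from `K` into the `p`-block.
[cite: FeldmanSalmhoferTrubowitz1999, §2.2 p0006:L48-55] -/
theorem isDOL_of_oneSided (hev : G.EvenIncidence) (h2 : G.IsTwoLegged) {p q : V} (hp : G.ext p = 1)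
    (hq : G.ext q = 1) (hpq : p ≠ q) (hsk : G.IsSkeleton) {W : Finset V}
    (hW : ∀ x, x ∈ W ↔ x ≠ p ∧ x ≠ q) {c : V} (hc : c ∈ W) {K : Finset V}
    (hK : ∀ x, x ∈ K ↔ G.Reachable (G.induced W) c x) (h0 : G.linesBetween K {q} = ∅) :
    G.IsDOL := by
  classical
  have hGc : G.IsConnected := hsk.1
  set comp : V → Finset V := fun v => Finset.univ.filter (fun x => G.Reachable (G.induced W) v x)
    with hcomp_def
  have hcomp : ∀ v x, x ∈ comp v ↔ G.Reachable (G.induced W) v x := fun v x => by simp [hcomp_def]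
  have hW' : ∀ x, x ∈ W ↔ x ≠ q ∧ x ≠ p := fun x => (hW x).trans and_comm
  have hKW : K ⊆ W := G.comp_subset hc hK
  have hpW : p ∉ W := fun h => ((hW p).1 h).1 rfl
  have hqW : q ∉ W := fun h => ((hW q).1 h).2 rfl
  have hpK : p ∉ K := fun h => hpW (hKW h)
  have hqK : q ∉ K := fun h => hqW (hKW h)
  have hKp : (G.linesBetween K {p}).Nonempty :=
    (G.comp_attached hGc hW hc hK).resolve_right (by rw [h0]; exact Finset.not_nonempty_empty)
  set A := insert q (W.filter fun v => v ∉ K ∧ (G.linesBetween (comp v) {q}).Nonempty) with hA_def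
  set Z := insert p (W.filter fun v => v ∉ K ∧ ¬ (G.linesBetween (comp v) {q}).Nonempty)
    with hZ_def
  have hA : ∀ x, x ∈ A ↔ x = q ∨ (x ∈ W ∧ x ∉ K ∧ (G.linesBetween (comp x) {q}).Nonempty) :=
    fun x => by simp only [hA_def, Finset.mem_insert, Finset.mem_filter]
  have hZ : ∀ x, x ∈ Z ↔ x = p ∨ (x ∈ W ∧ x ∉ K ∧ ¬ (G.linesBetween (comp x) {q}).Nonempty) :=
    fun x => by simp only [hZ_def, Finset.mem_insert, Finset.mem_filter]
  have hqA : q ∈ A := (hA q).2 (Or.inl rfl)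
  have hpZ : p ∈ Z := (hZ p).2 (Or.inl rfl)
  have hpA : p ∉ A := fun h => by
    rcases (hA p).1 h with h | ⟨h, -⟩
    · exact hpq h
    · exact hpW h
  have hAK : Disjoint A K := Finset.disjoint_left.2 fun x hxA hxK => by
    rcases (hA x).1 hxA with rfl | ⟨-, hxK', -⟩
    · exact hqK hxK
    · exact hxK' hxK
  have hKZ : Disjoint K Z := Finset.disjoint_left.2 fun x hxK hxZ => by
    rcases (hZ x).1 hxZ with rfl | ⟨-, hxK', -⟩
    · exact hpK hxK
    · exact hxK' hxK
  have hAZ : Disjoint A Z := Finset.disjoint_left.2 fun x hxA hxZ => by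
    rcases (hA x).1 hxA with rfl | ⟨hxW, -, hatt⟩ <;> rcases (hZ x).1 hxZ with h | ⟨hxW', -, hatt'⟩
    · exact hpq h.symm
    · exact hqW hxW'
    · exact hpW (h ▸ hxW)
    · exact hatt' hatt
  have hcover : ∀ v, v ∈ A ∨ v ∈ K ∨ v ∈ Z := by
    intro v
    by_cases hvq : v = q
    · exact Or.inl ((hA v).2 (Or.inl hvq))
    by_cases hvp : v = p
    · exact Or.inr (Or.inr ((hZ v).2 (Or.inl hvp)))
    have hvW : v ∈ W := (hW v).2 ⟨hvp, hvq⟩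
    by_cases hvK : v ∈ K
    · exact Or.inr (Or.inl hvK)
    by_cases hatt : (G.linesBetween (comp v) {q}).Nonempty
    · exact Or.inl ((hA v).2 (Or.inr ⟨hvW, hvK, hatt⟩))
    · exact Or.inr (Or.inr ((hZ v).2 (Or.inr ⟨hvW, hvK, hatt⟩)))
  have hAconn : G.IsConnectedOn A :=
    G.isConnectedOn_block hcomp hK (p := q) (P := fun C => (G.linesBetween C {q}).Nonempty)
      (fun _ _ h => h) hA
  have hZconn : G.IsConnectedOn Z :=
    G.isConnectedOn_block hcomp hK (p := p) (P := fun C => ¬ (G.linesBetween C {q}).Nonempty)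
      (fun v hv h => (G.comp_attached hGc hW hv (hcomp v)).resolve_right h) hZ
  have hKconn : G.IsConnectedOn K := G.isConnectedOn_of_comp hc hK
  have h3A : 3 ≤ (G.linesBetween A Aᶜ).card :=
    (G.three_le_card_bdry hev h2 hq hp hpq.symm hsk hqA hpA).1
  have h3KZ : 3 ≤ (G.linesBetween K Z).card := by
    have hsum := G.card_bdry_comp hpq hW hc hK
    obtain ⟨⟨r, hr⟩, hne2⟩ := G.even_card_bdry_of_not_mem hev h2 hp hq hpq hsk hpK hqK
    have hpos : 0 < (G.linesBetween K {p}).card := Finset.card_pos.2 hKp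
    rw [h0, Finset.card_empty, add_zero] at hsum
    have h4 : 3 ≤ (G.linesBetween K {p}).card := by omega
    exact h4.trans (Finset.card_le_card
      (G.linesBetween_mono_right K (Finset.singleton_subset_iff.2 hpZ)))
  exact G.isDOL_of_threeBlocks hAK hAZ hKZ hcover hAconn hKconn hZconn h3A h3KZ

/-- Under `¬DOL`, every component of `G - {a, b}` is joined to BOTH external vertices
(`isDOL_of_oneSided` in both orientations). [cite: FeldmanSalmhoferTrubowitz1999, §2.2 p0006:L48-55] -/
theorem twoSided_of_not_isDOL (hev : G.EvenIncidence) (h2 : G.IsTwoLegged) {a b : V}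
    (ha : G.ext a = 1) (hb : G.ext b = 1) (hab : a ≠ b) (hsk : G.IsSkeleton) (hndol : ¬ G.IsDOL)
    {W : Finset V} (hW : ∀ x, x ∈ W ↔ x ≠ a ∧ x ≠ b) {c : V} (hc : c ∈ W) {K : Finset V}
    (hK : ∀ x, x ∈ K ↔ G.Reachable (G.induced W) c x) :
    (G.linesBetween K {a}).Nonempty ∧ (G.linesBetween K {b}).Nonempty := by
  have hW' : ∀ x, x ∈ W ↔ x ≠ b ∧ x ≠ a := fun x => (hW x).trans and_comm
  constructor
  · exact Finset.nonempty_iff_ne_empty.2 fun h0 =>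
      hndol (G.isDOL_of_oneSided hev h2 hb ha hab.symm hsk hW' hc hK h0)
  · exact Finset.nonempty_iff_ne_empty.2 fun h0 =>
      hndol (G.isDOL_of_oneSided hev h2 ha hb hab hsk hW hc hK h0)

/-- Under `¬DOL`, every component of `G - {a, b}` is joined to `a` by exactly two lines and to `b`
by exactly two lines (three or more on one side is `isDOL_of_comp`; the boundary `m + n` is even,
`≠ 2`, and both `m, n ≥ 1`): the "`m_b + n_b = 4`" of p0006:L60-62 in its sharp form.
[cite: FeldmanSalmhoferTrubowitz1999, §2.2 p0006:L56-70] -/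
theorem card_lines_comp_eq_two (hev : G.EvenIncidence) (h2 : G.IsTwoLegged) {a b : V}
    (ha : G.ext a = 1) (hb : G.ext b = 1) (hab : a ≠ b) (hsk : G.IsSkeleton) (hndol : ¬ G.IsDOL)
    {W : Finset V} (hW : ∀ x, x ∈ W ↔ x ≠ a ∧ x ≠ b) {c : V} (hc : c ∈ W) {K : Finset V}
    (hK : ∀ x, x ∈ K ↔ G.Reachable (G.induced W) c x) :
    (G.linesBetween K {a}).card = 2 ∧ (G.linesBetween K {b}).card = 2 := by
  have hW' : ∀ x, x ∈ W ↔ x ≠ b ∧ x ≠ a := fun x => (hW x).trans and_comm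
  obtain ⟨ha1, hb1⟩ := G.twoSided_of_not_isDOL hev h2 ha hb hab hsk hndol hW hc hK
  have ha3 : ¬ 3 ≤ (G.linesBetween K {a}).card := fun h =>
    hndol (G.isDOL_of_comp hev h2 hb ha hab.symm hsk hW' hc hK h)
  have hb3 : ¬ 3 ≤ (G.linesBetween K {b}).card := fun h =>
    hndol (G.isDOL_of_comp hev h2 ha hb hab hsk hW hc hK h)
  have hKW : K ⊆ W := G.comp_subset hc hK
  have hsum := G.card_bdry_comp hab hW hc hK
  obtain ⟨⟨r, hr⟩, hne2⟩ := G.even_card_bdry_of_not_mem hev h2 ha hb hab hsk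
    (fun h => ((hW a).1 (hKW h)).1 rfl) (fun h => ((hW b).1 (hKW h)).2 rfl)
  have hpa : 0 < (G.linesBetween K {a}).card := Finset.card_pos.2 ha1
  have hpb : 0 < (G.linesBetween K {b}).card := Finset.card_pos.2 hb1
  constructor <;> omega

omit [Fintype V] [Fintype L] [DecidableEq V] [DecidableEq L] in
/-- Two lines sets "to a single vertex" from different vertices are disjoint: a line joining `x` to
`q` and `x'` to `q` has `x = x'` (for `x, x' ≠ q`). [cite: FeldmanSalmhoferTrubowitz1999, §2.2 p0006:L44-46] -/
theorem eq_of_joins_of_joins {l : L} {x x' q : V} (hx : x ≠ q) (hx' : x' ≠ q) (hj : G.Joins l x q)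
    (hj' : G.Joins l x' q) : x = x' := by
  rcases hj with ⟨h1, h2⟩ | ⟨h1, h2⟩ <;> rcases hj' with ⟨h3, h4⟩ | ⟨h3, h4⟩
  · exact h1.symm.trans h3
  · exact absurd (h1.symm.trans h3) hx
  · exact absurd (h3.symm.trans h1) hx'
  · exact h2.symm.trans h4

/-- **Two or more components make `G` DOL** ("We first show that for `a ≥ 2` components `C_b`
between `G₁` and `G₂`, the graph is DOL", p0006:L58-63 — here: with all `(m_b, n_b) = (2, 2)` by
`card_lines_comp_eq_two`, the blocks `K`, `a ∪` (other components), `{b}` carry `|∂K| = 4` and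
`m + 2 ≥ 3` lines into `b`). So under `¬DOL` (and `t = 1`) there is at most ONE component.
[cite: FeldmanSalmhoferTrubowitz1999, §2.2 p0006:L56-63] -/
theorem comp_eq_of_not_isDOL (hev : G.EvenIncidence) (h2 : G.IsTwoLegged) {a b : V}
    (ha : G.ext a = 1) (hb : G.ext b = 1) (hab : a ≠ b) (hsk : G.IsSkeleton) (hndol : ¬ G.IsDOL)
    (hadj : ∃ l : L, G.Joins l a b) {W : Finset V} (hW : ∀ x, x ∈ W ↔ x ≠ a ∧ x ≠ b)
    {c c' : V} (hc : c ∈ W) (hc' : c' ∈ W) {K K' : Finset V}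
    (hK : ∀ x, x ∈ K ↔ G.Reachable (G.induced W) c x)
    (hK' : ∀ x, x ∈ K' ↔ G.Reachable (G.induced W) c' x) : K = K' := by
  classical
  by_contra hKK'
  apply hndol
  set comp : V → Finset V := fun v => Finset.univ.filter (fun x => G.Reachable (G.induced W) v x)
    with hcomp_def
  have hcomp : ∀ v x, x ∈ comp v ↔ G.Reachable (G.induced W) v x := fun v x => by simp [hcomp_def]
  obtain ⟨hm2, hn2⟩ := G.card_lines_comp_eq_two hev h2 ha hb hab hsk hndol hW hc hK
  obtain ⟨-, hn2'⟩ := G.card_lines_comp_eq_two hev h2 ha hb hab hsk hndol hW hc' hK'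
  have hKW : K ⊆ W := G.comp_subset hc hK
  have hK'W : K' ⊆ W := G.comp_subset hc' hK'
  have haW : a ∉ W := fun h => ((hW a).1 h).1 rfl
  have hbW : b ∉ W := fun h => ((hW b).1 h).2 rfl
  set M := insert a (W.filter fun v => v ∉ K) with hM_def
  have hM : ∀ x, x ∈ M ↔ x = a ∨ (x ∈ W ∧ x ∉ K ∧ True) := fun x => by
    simp only [hM_def, Finset.mem_insert, Finset.mem_filter, and_true]
  have hMconn : G.IsConnectedOn M :=
    G.isConnectedOn_block hcomp hK (p := a) (P := fun _ => True)
      (fun v hv _ => (G.twoSided_of_not_isDOL hev h2 ha hb hab hsk hndol hW hv (hcomp v)).1) hM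
  have hKconn : G.IsConnectedOn K := G.isConnectedOn_of_comp hc hK
  have haM : a ∈ M := (hM a).2 (Or.inl rfl)
  have hK'M : K' ⊆ M := fun x hx =>
    (hM x).2 (Or.inr ⟨hK'W hx, fun hxK => hKK' (G.comp_eq_comp_of_mem hK hK' hxK hx), trivial⟩)
  -- three lines into `b`: one `a–b` line and the two from `K'`
  have hdisj : Disjoint (G.linesBetween {a} {b}) (G.linesBetween K' {b}) := by
    rw [Finset.disjoint_left]
    intro l hl hl'
    obtain ⟨x, hx, hj⟩ := G.exists_joins_of_mem_linesBetween_singleton hl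
    obtain ⟨x', hx', hj'⟩ := G.exists_joins_of_mem_linesBetween_singleton hl'
    rw [Finset.mem_singleton] at hx
    have hx'W := hK'W hx'
    have := G.eq_of_joins_of_joins (hx.symm ▸ hab) ((hW x').1 hx'W).2 hj hj'
    rw [← this, hx] at hx'W
    exact haW hx'W
  have h3 : 3 ≤ (G.linesBetween M {b}).card := by
    have hsub : G.linesBetween {a} {b} ∪ G.linesBetween K' {b} ⊆ G.linesBetween M {b} :=
      Finset.union_subset (G.linesBetween_mono_left (Finset.singleton_subset_iff.2 haM) _)
        (G.linesBetween_mono_left hK'M _)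
    have h1 : 1 ≤ (G.linesBetween {a} {b}).card := by
      obtain ⟨l, hl⟩ := hadj
      exact Finset.card_pos.2 ⟨l, G.mem_linesBetween_of_joins hl (Finset.mem_singleton_self _)
        (Finset.mem_singleton_self _)⟩
    have := Finset.card_le_card hsub
    rw [Finset.card_union_of_disjoint hdisj] at this
    omega
  have h3K : 3 ≤ (G.linesBetween K Kᶜ).card := by
    rw [G.card_bdry_comp hab hW hc hK]; omega
  have hKM : Disjoint K M := Finset.disjoint_left.2 fun x hxK hxM => by
    rcases (hM x).1 hxM with rfl | ⟨-, hxK', -⟩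
    · exact haW (hKW hxK)
    · exact hxK' hxK
  have hKb : Disjoint K {b} := Finset.disjoint_singleton_right.2 fun h => hbW (hKW h)
  have hMb : Disjoint M {b} := Finset.disjoint_singleton_right.2 fun h => by
    rcases (hM b).1 h with h | ⟨h, -⟩
    · exact hab h.symm
    · exact hbW h
  have hcover : ∀ v, v ∈ K ∨ v ∈ M ∨ v ∈ ({b} : Finset V) := by
    intro v
    by_cases hva : v = a
    · exact Or.inr (Or.inl ((hM v).2 (Or.inl hva)))
    by_cases hvb : v = b
    · exact Or.inr (Or.inr (Finset.mem_singleton.2 hvb))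
    have hvW : v ∈ W := (hW v).2 ⟨hva, hvb⟩
    by_cases hvK : v ∈ K
    · exact Or.inl hvK
    · exact Or.inr (Or.inl ((hM v).2 (Or.inr ⟨hvW, hvK, trivial⟩)))
  exact G.isDOL_of_threeBlocks hKM hKb hMb hcover hKconn hMconn (G.isConnectedOn_singleton b) h3K h3

/-- **No component: the sunset and the multiple sunset** ("If `G` has only these two vertices, then
`G` is the sunset diagram shown in Figure 1, or `G` is the multiple sunset shown in Figure 7",
p0006:L44-46): with `V = {a, b}` the lines joining `a` to `b` are exactly `∂{a}`, an odd number
`≥ 3` of them. [cite: FeldmanSalmhoferTrubowitz1999, §2.2 p0006:L44-46] -/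
theorem sunset_of_eq_empty (hev : G.EvenIncidence) (h2 : G.IsTwoLegged) {a b : V}
    (ha : G.ext a = 1) (hb : G.ext b = 1) (hab : a ≠ b) (hsk : G.IsSkeleton) {W : Finset V}
    (hW : ∀ x, x ∈ W ↔ x ≠ a ∧ x ≠ b) (hWe : W = ∅) :
    G.IsSunsetShape a b ∨ G.IsMultipleSunsetShape a b := by
  have huniv : Finset.univ = ({a, b} : Finset V) := by
    ext x
    simp only [Finset.mem_univ, Finset.mem_insert, Finset.mem_singleton, true_iff]
    by_contra h
    rw [not_or] at h
    have hx : x ∈ W := (hW x).2 ⟨h.1, h.2⟩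
    rw [hWe] at hx
    exact Finset.notMem_empty x hx
  have hcompl : ({a}ᶜ : Finset V) = {b} := by
    ext x
    simp only [Finset.mem_compl, Finset.mem_singleton]
    constructor
    · intro hxa
      have hx := Finset.mem_univ x
      rw [huniv, Finset.mem_insert, Finset.mem_singleton] at hx
      exact hx.resolve_left hxa
    · rintro rfl; exact hab.symm
  have hcount : G.lineCount a b = (G.linesBetween {a} {a}ᶜ).card := by
    rw [G.lineCount_eq_card_linesBetween, hcompl]
  obtain ⟨h3, hodd⟩ := G.three_le_card_bdry hev h2 ha hb hab hsk (Finset.mem_singleton_self a)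
    (fun h => hab (Finset.mem_singleton.1 h).symm)
  rw [← hcount] at h3 hodd
  obtain ⟨k, hk⟩ := hodd
  by_cases h3' : G.lineCount a b = 3
  · exact Or.inl ⟨hab, huniv, h3'⟩
  · exact Or.inr ⟨hab, huniv, by omega⟩

/-- **One component: `m = 1`** ("There remains the case `m = 1`", p0006:L71; `m ≥ 2` — here
`m ≥ 3`, `m` being odd — is DOL by the blocks `K`, `{a}`, `{b}`, p0006:L66-70): under `¬DOL`, if
`G - {a, b}` is ONE component `K = W ≠ ∅` then exactly one line joins `a` to `b`.
[cite: FeldmanSalmhoferTrubowitz1999, §2.2 p0006:L66-71] -/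
theorem card_lines_ab_eq_one (hev : G.EvenIncidence) (h2 : G.IsTwoLegged) {a b : V}
    (ha : G.ext a = 1) (hb : G.ext b = 1) (hab : a ≠ b) (hsk : G.IsSkeleton) (hndol : ¬ G.IsDOL)
    {W : Finset V} (hW : ∀ x, x ∈ W ↔ x ≠ a ∧ x ≠ b) {c : V} (hc : c ∈ W)
    (hKW : ∀ x, x ∈ W ↔ G.Reachable (G.induced W) c x) :
    (G.linesBetween {a} {b}).card = 1 := by
  obtain ⟨hm2, hn2⟩ := G.card_lines_comp_eq_two hev h2 ha hb hab hsk hndol hW hc hKW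
  have haW : a ∉ W := fun h => ((hW a).1 h).1 rfl
  have hbW : b ∉ W := fun h => ((hW b).1 h).2 rfl
  -- `m ≤ 2`, else the blocks `W | {a} | {b}` are DOL
  have hle : ¬ 3 ≤ (G.linesBetween {a} {b}).card := by
    intro h3
    apply hndol
    have h3W : 3 ≤ (G.linesBetween W Wᶜ).card := by
      rw [G.card_bdry_comp hab hW hc hKW]; omega
    refine G.isDOL_of_threeBlocks (A := W) (M := {a}) (Z := {b})
      (Finset.disjoint_singleton_right.2 haW) (Finset.disjoint_singleton_right.2 hbW)
      (Finset.disjoint_singleton.2 hab) (fun v => ?_) (G.isConnectedOn_of_comp hc hKW)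
      (G.isConnectedOn_singleton a) (G.isConnectedOn_singleton b) h3W h3
    by_cases hva : v = a
    · exact Or.inr (Or.inl (Finset.mem_singleton.2 hva))
    by_cases hvb : v = b
    · exact Or.inr (Or.inr (Finset.mem_singleton.2 hvb))
    · exact Or.inl ((hW v).2 ⟨hva, hvb⟩)
  -- parity at `b`: `|∂{b}| = m + 2` is odd
  have hodd := (G.three_le_card_bdry hev h2 hb ha hab.symm hsk (Finset.mem_singleton_self b)
    (fun h => hab (Finset.mem_singleton.1 h))).2
  have hcompl : ({b}ᶜ : Finset V) = {a} ∪ W := by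
    ext x
    simp only [Finset.mem_compl, Finset.mem_singleton, Finset.mem_union, hW]
    constructor
    · intro hxb
      by_cases hxa : x = a
      · exact Or.inl hxa
      · exact Or.inr ⟨hxa, hxb⟩
    · rintro (rfl | ⟨-, hxb⟩)
      · exact hab
      · exact hxb
  have hdisj : Disjoint (G.linesBetween {b} {a}) (G.linesBetween {b} W) := by
    rw [G.linesBetween_comm {b} {a}, G.linesBetween_comm {b} W, Finset.disjoint_left]
    intro l hl hl'
    obtain ⟨x, hx, hj⟩ := G.exists_joins_of_mem_linesBetween_singleton hl
    obtain ⟨x', hx', hj'⟩ := G.exists_joins_of_mem_linesBetween_singleton hl'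
    rw [Finset.mem_singleton] at hx
    have hx'b : x' ≠ b := ((hW x').1 hx').2
    have := G.eq_of_joins_of_joins (hx.symm ▸ hab) hx'b hj hj'
    rw [← this, hx] at hx'
    exact haW hx'
  rw [hcompl, G.linesBetween_union_right, Finset.card_union_of_disjoint hdisj,
    G.linesBetween_comm {b} {a}, G.linesBetween_comm {b} W, hn2] at hodd
  obtain ⟨k, hk⟩ := hodd
  omega

end Thm26Reductions


/-! ### §10 The wicked-ladder induction: one step (components of `G - a - P`, budgets at `a`) -/

section LadderStep

variable [Fintype V] [Fintype L] [DecidableEq V] [DecidableEq L]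

omit [Fintype V] in
/-- `linesBetween` distributes over a union in the first slot. [cite: FeldmanSalmhoferTrubowitz1999, Lemma 2.5 (proof) p0005:L92-95] -/
theorem linesBetween_union_left (A A' B : Finset V) :
    G.linesBetween (A ∪ A') B = G.linesBetween A B ∪ G.linesBetween A' B := by
  rw [G.linesBetween_comm, G.linesBetween_union_right, G.linesBetween_comm B A,
    G.linesBetween_comm B A']

omit [Fintype V] [DecidableEq L] in
/-- Lines from `J` into two disjoint sets, both disjoint from `J`, are different lines.
[cite: FeldmanSalmhoferTrubowitz1999, Lemma 2.5 (proof) p0005:L92-95] -/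
theorem disjoint_linesBetween {J B B' : Finset V} (hJB : Disjoint J B) (hJB' : Disjoint J B')
    (hBB' : Disjoint B B') : Disjoint (G.linesBetween J B) (G.linesBetween J B') := by
  rw [Finset.disjoint_left]
  intro l hl hl'
  rw [mem_linesBetween] at hl hl'
  rcases hl with ⟨h1, h2⟩ | ⟨h1, h2⟩ <;> rcases hl' with ⟨h3, h4⟩ | ⟨h3, h4⟩
  · exact Finset.disjoint_left.1 hBB' h2 h4
  · exact Finset.disjoint_left.1 hJB' h1 h3
  · exact Finset.disjoint_left.1 hJB h3 h1
  · exact Finset.disjoint_left.1 hBB' h1 h3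

omit [Fintype V] [DecidableEq L] in
/-- Two connected blocks joined by a line span a connected subgraph together.
[cite: FeldmanSalmhoferTrubowitz1999, Lemma 2.5 (proof) p0005:L108-113] -/
theorem isConnectedOn_union_of_joins {X Y : Finset V} (hX : G.IsConnectedOn X)
    (hY : G.IsConnectedOn Y) {x y : V} (hx : x ∈ X) (hy : y ∈ Y) {l : L} (hj : G.Joins l x y) :
    G.IsConnectedOn (X ∪ Y) :=
  G.connectsOn_union_of_joins hX hY (G.induced_mono Finset.subset_union_left)
    (G.induced_mono Finset.subset_union_right)
    (G.mem_induced_of_joins hj (Finset.mem_union_left _ hx) (Finset.mem_union_right _ hy)) hj hx hy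

/-- LADDER STATE PARITY. In a ladder state (`b ∈ P`, `a ∉ P`) exactly ONE boundary line of `P` is an
`a–b` line (there is exactly one such line, `m = 1`), so the REDUCED boundary
`E = {l ∈ ∂P | l is not an a–b line}` has `|∂P| - 1` lines: an EVEN number, at least `2`.
[cite: FeldmanSalmhoferTrubowitz1999, §2.2 p0006:L71-75] -/
theorem card_reducedBdry (hev : G.EvenIncidence) (h2 : G.IsTwoLegged) {a b : V} (ha : G.ext a = 1)
    (hb : G.ext b = 1) (hab : a ≠ b) (hsk : G.IsSkeleton) (hm : (G.linesBetween {a} {b}).card = 1)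
    {P : Finset V} (hbP : b ∈ P) (haP : a ∉ P) :
    Even ((G.linesBetween P Pᶜ).filter fun l => ¬ G.Joins l a b).card ∧
      2 ≤ ((G.linesBetween P Pᶜ).filter fun l => ¬ G.Joins l a b).card := by
  have hsplit := Finset.card_filter_add_card_filter_not
    (s := G.linesBetween P Pᶜ) (fun l => G.Joins l a b)
  have hfilter : (G.linesBetween P Pᶜ).filter (fun l => G.Joins l a b) = G.linesBetween {a} {b} := by
    ext l
    simp only [Finset.mem_filter]
    constructor
    · rintro ⟨-, hj⟩
      exact G.mem_linesBetween_of_joins hj (Finset.mem_singleton_self _) (Finset.mem_singleton_self _)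
    · intro hl
      obtain ⟨x, hx, hj⟩ := G.exists_joins_of_mem_linesBetween_singleton hl
      rw [Finset.mem_singleton] at hx
      rw [hx] at hj
      exact ⟨G.mem_linesBetween_of_joins hj.symm hbP (Finset.mem_compl.2 haP), hj⟩
  rw [hfilter, hm] at hsplit
  obtain ⟨h3, ⟨k, hk⟩⟩ := G.three_le_card_bdry hev h2 hb ha hab.symm hsk hbP haP
  exact ⟨⟨k, by omega⟩, by omega⟩

omit [Fintype L] [DecidableEq L] in
/-- In a ladder state every reduced boundary line joins the tip `u` to a vertex `y` outside `P`, and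
`y` is `a` or an inner vertex. [cite: FeldmanSalmhoferTrubowitz1999, §2.2 p0006:L95-103] -/
theorem exists_outer_end {a b : V} {W : Finset V} (hW : ∀ x, x ∈ W ↔ x ≠ a ∧ x ≠ b)
    [Fintype L] {P : Finset V} {u : V} (hbP : b ∈ P) (huP : u ∈ P)
    (hbd : ∀ l ∈ G.linesBetween P Pᶜ, ¬ G.Joins l a b → G.fst l = u ∨ G.snd l = u)
    {l : L} (hl : l ∈ (G.linesBetween P Pᶜ).filter fun l => ¬ G.Joins l a b) :
    ∃ y, y ∉ P ∧ G.Joins l u y ∧ (y = a ∨ y ∈ W) := by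
  obtain ⟨hl, hnab⟩ := Finset.mem_filter.1 hl
  have hu := hbd l hl hnab
  rw [mem_linesBetween] at hl
  simp only [Finset.mem_compl] at hl
  have hyW : ∀ y, y ∉ P → (y = a ∨ y ∈ W) := fun y hy => by
    by_cases hya : y = a
    · exact Or.inl hya
    · exact Or.inr ((hW y).2 ⟨hya, fun hyb => hy (hyb ▸ hbP)⟩)
  rcases hl with ⟨h1, h2⟩ | ⟨h1, h2⟩
  · rcases hu with hu | hu
    · exact ⟨G.snd l, h2, Or.inl ⟨hu, rfl⟩, hyW _ h2⟩
    · exact absurd (hu ▸ huP) h2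
  · rcases hu with hu | hu
    · exact absurd (hu ▸ huP) h1
    · exact ⟨G.fst l, h1, Or.inr ⟨rfl, hu⟩, hyW _ h1⟩

/-- COMPONENTS OF `G - a - P` IN A LADDER STATE: the boundary of a component `J` of the subgraph
spanned by `K' = W - P` consists of its lines to `a` and its lines to `P`, the latter all ending at
the tip `u`; these are different lines, and `|∂J| = |lines to a| + |lines to P|`.
[cite: FeldmanSalmhoferTrubowitz1999, §2.2 p0006:L48-55] -/
theorem card_bdry_ladderComp {a b : V} {W : Finset V}
    (hW : ∀ x, x ∈ W ↔ x ≠ a ∧ x ≠ b) {P : Finset V} {u : V} (hbP : b ∈ P) (haP : a ∉ P)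
    (huP : u ∈ P) (hbd : ∀ l ∈ G.linesBetween P Pᶜ, ¬ G.Joins l a b → G.fst l = u ∨ G.snd l = u)
    {K' : Finset V} (hK' : K' = W \ P) {c : V} (hc : c ∈ K') {J : Finset V}
    (hJ : ∀ x, x ∈ J ↔ G.Reachable (G.induced K') c x) :
    Disjoint J P ∧ a ∉ J ∧ b ∉ J ∧
    G.linesBetween J Jᶜ = G.linesBetween J {a} ∪ G.linesBetween J P ∧
    Disjoint (G.linesBetween J {a}) (G.linesBetween J P) ∧
    (G.linesBetween J Jᶜ).card = (G.linesBetween J {a}).card + (G.linesBetween J P).card ∧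
    (∀ l ∈ G.linesBetween J P, ∃ x ∈ J, G.Joins l x u) := by
  have hJK : J ⊆ K' := G.comp_subset hc hJ
  have hK'W : K' ⊆ W := fun x hx => (Finset.mem_sdiff.1 (hK' ▸ hx)).1
  have hK'P : ∀ x ∈ K', x ∉ P := fun x hx => (Finset.mem_sdiff.1 (hK' ▸ hx)).2
  have hJP : Disjoint J P := Finset.disjoint_left.2 fun x hx hxP => hK'P x (hJK hx) hxP
  have haJ : a ∉ J := fun h => ((hW a).1 (hK'W (hJK h))).1 rfl
  have hbJ : b ∉ J := fun h => ((hW b).1 (hK'W (hJK h))).2 rfl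
  have hJa : Disjoint J {a} := Finset.disjoint_singleton_right.2 haJ
  have haPd : Disjoint ({a} : Finset V) P := Finset.disjoint_singleton_left.2 haP
  have heq : G.linesBetween J Jᶜ = G.linesBetween J {a} ∪ G.linesBetween J P := by
    rw [← G.linesBetween_union_right]
    ext l
    constructor
    · intro hl
      obtain ⟨x, hx, z, hz, hj⟩ := G.exists_joins_of_mem_bdry hl
      refine G.mem_linesBetween_of_joins hj hx ?_
      rw [Finset.mem_union, Finset.mem_singleton]
      have hzK' : z ∉ K' := fun hzK' => hz (G.comp_mem_of_joins hc hJ hx hj hzK')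
      rw [hK', Finset.mem_sdiff, not_and, not_not] at hzK'
      by_cases hzP : z ∈ P
      · exact Or.inr hzP
      · have hzW : z ∉ W := fun hzW => hzP (hzK' hzW)
        rw [hW, not_and_or, not_not, not_not] at hzW
        rcases hzW with hza | hzb
        · exact Or.inl hza
        · exact absurd (hzb ▸ hbP) hzP
    · intro hl
      obtain ⟨x, hx, z, hz, hj⟩ := G.exists_joins_of_mem_linesBetween hl
      refine G.mem_bdry_of_joins hj hx ?_
      rw [Finset.mem_union, Finset.mem_singleton] at hz
      rcases hz with rfl | hzP
      · exact haJ
      · exact fun hzJ => Finset.disjoint_left.1 hJP hzJ hzP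
  have hdisj : Disjoint (G.linesBetween J {a}) (G.linesBetween J P) :=
    G.disjoint_linesBetween hJa hJP haPd
  refine ⟨hJP, haJ, hbJ, heq, hdisj, by rw [heq, Finset.card_union_of_disjoint hdisj], ?_⟩
  intro l hl
  obtain ⟨x, hx, z, hz, hj⟩ := G.exists_joins_of_mem_linesBetween hl
  have hxP : x ∉ P := fun h => Finset.disjoint_left.1 hJP hx h
  have hbd' := hbd l (G.mem_linesBetween_of_joins hj.symm hz (Finset.mem_compl.2 hxP)) (by
    intro hjab
    have hxW := hK'W (hJK hx)
    rcases hj.eq_fst_or_eq_snd with h | h <;> rcases hjab with ⟨h1, h2⟩ | ⟨h1, h2⟩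
    · exact ((hW x).1 hxW).1 (h.trans h1)
    · exact ((hW x).1 hxW).2 (h.trans h1)
    · exact ((hW x).1 hxW).2 (h.trans h2)
    · exact ((hW x).1 hxW).1 (h.trans h2))
  refine ⟨x, hx, ?_⟩
  rcases hj with ⟨h1, h2⟩ | ⟨h1, h2⟩ <;> rcases hbd' with hu | hu
  · exact absurd (h1.symm.trans hu ▸ huP) hxP
  · exact Or.inl ⟨h1, hu⟩
  · exact Or.inr ⟨hu, h2⟩
  · exact absurd (h2.symm.trans hu ▸ huP) hxP

end LadderStep


section LadderBlocks

variable [Fintype V] [Fintype L] [DecidableEq V] [DecidableEq L]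

/-- LADDER STEP, excluded configuration 1: a component of `G - a - P` NOT joined to `a` makes `G`
DOL (blocks `a ∪` (components joined to `a`), the component, `P ∪` (the rest); it sends `|∂J| ≥ 4`
lines into `P`). [cite: FeldmanSalmhoferTrubowitz1999, §2.2 p0006:L48-55] -/
theorem isDOL_of_ladderComp_not_a (hev : G.EvenIncidence) (h2 : G.IsTwoLegged) {a b : V}
    (ha : G.ext a = 1) (hb : G.ext b = 1) (hab : a ≠ b) (hsk : G.IsSkeleton) {W : Finset V}
    (hW : ∀ x, x ∈ W ↔ x ≠ a ∧ x ≠ b) {P : Finset V} {u : V} (hbP : b ∈ P) (haP : a ∉ P)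
    (huP : u ∈ P) (hPconn : G.IsConnectedOn P)
    (hbd : ∀ l ∈ G.linesBetween P Pᶜ, ¬ G.Joins l a b → G.fst l = u ∨ G.snd l = u)
    {K' : Finset V} (hK' : K' = W \ P) {compK : V → Finset V}
    (hcompK : ∀ c x, x ∈ compK c ↔ G.Reachable (G.induced K') c x) {c : V} (hc : c ∈ K')
    (h0 : G.linesBetween (compK c) {a} = ∅) : G.IsDOL := by
  classical
  have hJ := hcompK c
  obtain ⟨hJP, haJ, hbJ, -, -, hcardJ, -⟩ := G.card_bdry_ladderComp hW hbP haP huP hbd hK' hc hJ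
  obtain ⟨⟨r, hr⟩, hne2, h1⟩ := G.card_linesBetween_compl_of_avoids hev h2 ha hb hab hsk haJ hbJ
    ⟨c, G.mem_comp_self hJ⟩
  have hK'W : K' ⊆ W := fun x hx => (Finset.mem_sdiff.1 (hK' ▸ hx)).1
  have hK'P : ∀ x ∈ K', x ∉ P := fun x hx => (Finset.mem_sdiff.1 (hK' ▸ hx)).2
  have haK' : a ∉ K' := fun h => ((hW a).1 (hK'W h)).1 rfl
  have hbK' : b ∉ K' := fun h => ((hW b).1 (hK'W h)).2 rfl
  have hmemK' : ∀ y, y ∉ P → y ≠ a → y ∈ K' := fun y hy hya =>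
    hK' ▸ Finset.mem_sdiff.2 ⟨(hW y).2 ⟨hya, fun hyb => hy (hyb ▸ hbP)⟩, hy⟩
  have hcomp_ne : ∀ x ∈ K', x ∉ compK c → compK x ≠ compK c := fun x _ hx h =>
    hx (h ▸ G.mem_comp_self (hcompK x))
  set A := insert a (K'.filter fun v => compK v ≠ compK c ∧ (G.linesBetween (compK v) {a}).Nonempty)
    with hA_def
  set Z := P ∪ (K'.filter fun v => compK v ≠ compK c ∧ ¬ (G.linesBetween (compK v) {a}).Nonempty)
    with hZ_def
  have hA : ∀ x, x ∈ A ↔ x ∈ ({a} : Finset V) ∨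
      (x ∈ K' ∧ (compK x ≠ compK c ∧ (G.linesBetween (compK x) {a}).Nonempty)) := fun x => by
    simp only [hA_def, Finset.mem_insert, Finset.mem_filter, Finset.mem_singleton]
  have hZ : ∀ x, x ∈ Z ↔ x ∈ P ∨
      (x ∈ K' ∧ (compK x ≠ compK c ∧ ¬ (G.linesBetween (compK x) {a}).Nonempty)) := fun x => by
    simp only [hZ_def, Finset.mem_union, Finset.mem_filter]
  have hAconn : G.IsConnectedOn A :=
    G.isConnectedOn_blockBase hcompK (G.isConnectedOn_singleton a) (Finset.mem_singleton_self a)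
      (P := fun C => C ≠ compK c ∧ (G.linesBetween C {a}).Nonempty) (fun _ _ h => h.2) hA
  have hZconn : G.IsConnectedOn Z := by
    refine G.isConnectedOn_blockBase hcompK hPconn hbP
      (P := fun C => C ≠ compK c ∧ ¬ (G.linesBetween C {a}).Nonempty) (fun v hv h => ?_) hZ
    obtain ⟨-, haJ', hbJ', -, -, hcard', -⟩ :=
      G.card_bdry_ladderComp hW hbP haP huP hbd hK' hv (hcompK v)
    obtain ⟨-, -, h1'⟩ := G.card_linesBetween_compl_of_avoids hev h2 ha hb hab hsk haJ' hbJ'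
      ⟨v, G.mem_comp_self (hcompK v)⟩
    have h0' : (G.linesBetween (compK v) {a}).card = 0 :=
      Finset.card_eq_zero.2 (Finset.not_nonempty_iff_eq_empty.1 h.2)
    exact Finset.card_pos.1 (by omega)
  have hJconn : G.IsConnectedOn (compK c) := G.isConnectedOn_of_comp hc hJ
  have haA : a ∈ A := (hA a).2 (Or.inl (Finset.mem_singleton_self a))
  have hbA : b ∉ A := fun h => by
    rcases (hA b).1 h with h | ⟨h, -⟩
    · exact hab (Finset.mem_singleton.1 h).symm
    · exact hbK' h
  have h3A : 3 ≤ (G.linesBetween A Aᶜ).card := (G.three_le_card_bdry hev h2 ha hb hab hsk haA hbA).1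
  have h3 : 3 ≤ (G.linesBetween (compK c) Z).card := by
    rw [h0, Finset.card_empty, zero_add] at hcardJ
    have h4 : 3 ≤ (G.linesBetween (compK c) P).card := by omega
    exact h4.trans (Finset.card_le_card (G.linesBetween_mono_right _ Finset.subset_union_left))
  have hAJ : Disjoint A (compK c) := Finset.disjoint_left.2 fun x hxA hxJ => by
    rcases (hA x).1 hxA with h | ⟨hxK', hne, -⟩
    · exact haJ (Finset.mem_singleton.1 h ▸ hxJ)
    · exact hne (G.comp_eq_comp_of_mem (hcompK x) hJ (G.mem_comp_self (hcompK x)) hxJ)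
  have hJZ : Disjoint (compK c) Z := Finset.disjoint_left.2 fun x hxJ hxZ => by
    rcases (hZ x).1 hxZ with h | ⟨-, hne, -⟩
    · exact Finset.disjoint_left.1 hJP hxJ h
    · exact hne (G.comp_eq_comp_of_mem (hcompK x) hJ (G.mem_comp_self (hcompK x)) hxJ)
  have hAZ : Disjoint A Z := Finset.disjoint_left.2 fun x hxA hxZ => by
    rcases (hA x).1 hxA with h | ⟨hxK', -, hatt⟩ <;> rcases (hZ x).1 hxZ with h' | ⟨hxK'', -, hatt'⟩
    · exact haP (Finset.mem_singleton.1 h ▸ h')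
    · exact haK' (Finset.mem_singleton.1 h ▸ hxK'')
    · exact hK'P x hxK' h'
    · exact hatt' hatt
  have hcover : ∀ v, v ∈ A ∨ v ∈ compK c ∨ v ∈ Z := by
    intro v
    by_cases hva : v = a
    · exact Or.inl ((hA v).2 (Or.inl (Finset.mem_singleton.2 hva)))
    by_cases hvP : v ∈ P
    · exact Or.inr (Or.inr ((hZ v).2 (Or.inl hvP)))
    have hvK' : v ∈ K' := hmemK' v hvP hva
    by_cases hvJ : v ∈ compK c
    · exact Or.inr (Or.inl hvJ)
    have hne := hcomp_ne v hvK' hvJ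
    by_cases hatt : (G.linesBetween (compK v) {a}).Nonempty
    · exact Or.inl ((hA v).2 (Or.inr ⟨hvK', hne, hatt⟩))
    · exact Or.inr (Or.inr ((hZ v).2 (Or.inr ⟨hvK', hne, hatt⟩)))
  exact G.isDOL_of_threeBlocks hAJ hAZ hJZ hcover hAconn hJconn hZconn h3A h3

/-- LADDER STEP, excluded configuration 2: a component of `G - a - P` NOT joined to `P` makes `G`
DOL (blocks `P ∪` (components joined to `P`), the component, `a ∪` (the rest); it sends `|∂J| ≥ 4`
lines to `a`). [cite: FeldmanSalmhoferTrubowitz1999, §2.2 p0006:L48-55] -/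
theorem isDOL_of_ladderComp_not_P (hev : G.EvenIncidence) (h2 : G.IsTwoLegged) {a b : V}
    (ha : G.ext a = 1) (hb : G.ext b = 1) (hab : a ≠ b) (hsk : G.IsSkeleton) {W : Finset V}
    (hW : ∀ x, x ∈ W ↔ x ≠ a ∧ x ≠ b) {P : Finset V} {u : V} (hbP : b ∈ P) (haP : a ∉ P)
    (huP : u ∈ P) (hPconn : G.IsConnectedOn P)
    (hbd : ∀ l ∈ G.linesBetween P Pᶜ, ¬ G.Joins l a b → G.fst l = u ∨ G.snd l = u)
    {K' : Finset V} (hK' : K' = W \ P) {compK : V → Finset V}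
    (hcompK : ∀ c x, x ∈ compK c ↔ G.Reachable (G.induced K') c x) {c : V} (hc : c ∈ K')
    (h0 : G.linesBetween (compK c) P = ∅) : G.IsDOL := by
  classical
  have hJ := hcompK c
  obtain ⟨hJP, haJ, hbJ, -, -, hcardJ, -⟩ := G.card_bdry_ladderComp hW hbP haP huP hbd hK' hc hJ
  obtain ⟨⟨r, hr⟩, hne2, h1⟩ := G.card_linesBetween_compl_of_avoids hev h2 ha hb hab hsk haJ hbJ
    ⟨c, G.mem_comp_self hJ⟩
  have hK'W : K' ⊆ W := fun x hx => (Finset.mem_sdiff.1 (hK' ▸ hx)).1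
  have hK'P : ∀ x ∈ K', x ∉ P := fun x hx => (Finset.mem_sdiff.1 (hK' ▸ hx)).2
  have haK' : a ∉ K' := fun h => ((hW a).1 (hK'W h)).1 rfl
  have hbK' : b ∉ K' := fun h => ((hW b).1 (hK'W h)).2 rfl
  have hmemK' : ∀ y, y ∉ P → y ≠ a → y ∈ K' := fun y hy hya =>
    hK' ▸ Finset.mem_sdiff.2 ⟨(hW y).2 ⟨hya, fun hyb => hy (hyb ▸ hbP)⟩, hy⟩
  have hcomp_ne : ∀ x ∈ K', x ∉ compK c → compK x ≠ compK c := fun x _ hx h =>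
    hx (h ▸ G.mem_comp_self (hcompK x))
  set A := P ∪ (K'.filter fun v => compK v ≠ compK c ∧ (G.linesBetween (compK v) P).Nonempty)
    with hA_def
  set Z := insert a (K'.filter fun v => compK v ≠ compK c ∧ ¬ (G.linesBetween (compK v) P).Nonempty)
    with hZ_def
  have hA : ∀ x, x ∈ A ↔ x ∈ P ∨
      (x ∈ K' ∧ (compK x ≠ compK c ∧ (G.linesBetween (compK x) P).Nonempty)) := fun x => by
    simp only [hA_def, Finset.mem_union, Finset.mem_filter]
  have hZ : ∀ x, x ∈ Z ↔ x ∈ ({a} : Finset V) ∨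
      (x ∈ K' ∧ (compK x ≠ compK c ∧ ¬ (G.linesBetween (compK x) P).Nonempty)) := fun x => by
    simp only [hZ_def, Finset.mem_insert, Finset.mem_filter, Finset.mem_singleton]
  have hAconn : G.IsConnectedOn A :=
    G.isConnectedOn_blockBase hcompK hPconn hbP
      (P := fun C => C ≠ compK c ∧ (G.linesBetween C P).Nonempty) (fun _ _ h => h.2) hA
  have hZconn : G.IsConnectedOn Z := by
    refine G.isConnectedOn_blockBase hcompK (G.isConnectedOn_singleton a) (Finset.mem_singleton_self a)
      (P := fun C => C ≠ compK c ∧ ¬ (G.linesBetween C P).Nonempty) (fun v hv h => ?_) hZ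
    obtain ⟨-, haJ', hbJ', -, -, hcard', -⟩ :=
      G.card_bdry_ladderComp hW hbP haP huP hbd hK' hv (hcompK v)
    obtain ⟨-, -, h1'⟩ := G.card_linesBetween_compl_of_avoids hev h2 ha hb hab hsk haJ' hbJ'
      ⟨v, G.mem_comp_self (hcompK v)⟩
    have h0' : (G.linesBetween (compK v) P).card = 0 :=
      Finset.card_eq_zero.2 (Finset.not_nonempty_iff_eq_empty.1 h.2)
    exact Finset.card_pos.1 (by omega)
  have hJconn : G.IsConnectedOn (compK c) := G.isConnectedOn_of_comp hc hJ
  have hbA : b ∈ A := (hA b).2 (Or.inl hbP)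
  have haA : a ∉ A := fun h => by
    rcases (hA a).1 h with h | ⟨h, -⟩
    · exact haP h
    · exact haK' h
  have h3A : 3 ≤ (G.linesBetween A Aᶜ).card :=
    (G.three_le_card_bdry hev h2 hb ha hab.symm hsk hbA haA).1
  have haZ : a ∈ Z := (hZ a).2 (Or.inl (Finset.mem_singleton_self a))
  have h3 : 3 ≤ (G.linesBetween (compK c) Z).card := by
    rw [h0, Finset.card_empty, add_zero] at hcardJ
    have h4 : 3 ≤ (G.linesBetween (compK c) {a}).card := by omega
    exact h4.trans (Finset.card_le_card
      (G.linesBetween_mono_right _ (Finset.singleton_subset_iff.2 haZ)))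
  have hAJ : Disjoint A (compK c) := Finset.disjoint_left.2 fun x hxA hxJ => by
    rcases (hA x).1 hxA with h | ⟨hxK', hne, -⟩
    · exact Finset.disjoint_left.1 hJP hxJ h
    · exact hne (G.comp_eq_comp_of_mem (hcompK x) hJ (G.mem_comp_self (hcompK x)) hxJ)
  have hJZ : Disjoint (compK c) Z := Finset.disjoint_left.2 fun x hxJ hxZ => by
    rcases (hZ x).1 hxZ with h | ⟨-, hne, -⟩
    · exact haJ (Finset.mem_singleton.1 h ▸ hxJ)
    · exact hne (G.comp_eq_comp_of_mem (hcompK x) hJ (G.mem_comp_self (hcompK x)) hxJ)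
  have hAZ : Disjoint A Z := Finset.disjoint_left.2 fun x hxA hxZ => by
    rcases (hA x).1 hxA with h | ⟨hxK', -, hatt⟩ <;> rcases (hZ x).1 hxZ with h' | ⟨hxK'', -, hatt'⟩
    · exact haP (Finset.mem_singleton.1 h' ▸ h)
    · exact hK'P x hxK'' h
    · exact haK' (Finset.mem_singleton.1 h' ▸ hxK')
    · exact hatt' hatt
  have hcover : ∀ v, v ∈ A ∨ v ∈ compK c ∨ v ∈ Z := by
    intro v
    by_cases hva : v = a
    · exact Or.inr (Or.inr ((hZ v).2 (Or.inl (Finset.mem_singleton.2 hva))))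
    by_cases hvP : v ∈ P
    · exact Or.inl ((hA v).2 (Or.inl hvP))
    have hvK' : v ∈ K' := hmemK' v hvP hva
    by_cases hvJ : v ∈ compK c
    · exact Or.inr (Or.inl hvJ)
    have hne := hcomp_ne v hvK' hvJ
    by_cases hatt : (G.linesBetween (compK v) P).Nonempty
    · exact Or.inl ((hA v).2 (Or.inr ⟨hvK', hne, hatt⟩))
    · exact Or.inr (Or.inr ((hZ v).2 (Or.inr ⟨hvK', hne, hatt⟩)))
  exact G.isDOL_of_threeBlocks hAJ hAZ hJZ hcover hAconn hJconn hZconn h3A h3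

/-- LADDER STEP, excluded configuration 3: a component of `G - a - P` joined to `P` by at least
three lines makes `G` DOL (blocks `{a}`, the component, `P ∪` (the other components) — the latter
are joined to `P`, else configuration 2). [cite: FeldmanSalmhoferTrubowitz1999, §2.2 p0006:L66-80] -/
theorem false_of_ladderComp_three (hev : G.EvenIncidence) (h2 : G.IsTwoLegged) {a b : V}
    (ha : G.ext a = 1) (hb : G.ext b = 1) (hab : a ≠ b) (hsk : G.IsSkeleton) (hndol : ¬ G.IsDOL)
    {W : Finset V} (hW : ∀ x, x ∈ W ↔ x ≠ a ∧ x ≠ b) {P : Finset V} {u : V} (hbP : b ∈ P)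
    (haP : a ∉ P) (huP : u ∈ P) (hPconn : G.IsConnectedOn P)
    (hbd : ∀ l ∈ G.linesBetween P Pᶜ, ¬ G.Joins l a b → G.fst l = u ∨ G.snd l = u)
    {K' : Finset V} (hK' : K' = W \ P) {compK : V → Finset V}
    (hcompK : ∀ c x, x ∈ compK c ↔ G.Reachable (G.induced K') c x) {c : V} (hc : c ∈ K')
    (h3 : 3 ≤ (G.linesBetween (compK c) P).card) : False := by
  classical
  apply hndol
  have hJ := hcompK c
  obtain ⟨hJP, haJ, hbJ, -, -, -, -⟩ := G.card_bdry_ladderComp hW hbP haP huP hbd hK' hc hJ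
  have hK'W : K' ⊆ W := fun x hx => (Finset.mem_sdiff.1 (hK' ▸ hx)).1
  have hK'P : ∀ x ∈ K', x ∉ P := fun x hx => (Finset.mem_sdiff.1 (hK' ▸ hx)).2
  have haK' : a ∉ K' := fun h => ((hW a).1 (hK'W h)).1 rfl
  have hmemK' : ∀ y, y ∉ P → y ≠ a → y ∈ K' := fun y hy hya =>
    hK' ▸ Finset.mem_sdiff.2 ⟨(hW y).2 ⟨hya, fun hyb => hy (hyb ▸ hbP)⟩, hy⟩
  have hcomp_ne : ∀ x ∈ K', x ∉ compK c → compK x ≠ compK c := fun x _ hx h =>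
    hx (h ▸ G.mem_comp_self (hcompK x))
  set Z := P ∪ (K'.filter fun v => compK v ≠ compK c) with hZ_def
  have hZ : ∀ x, x ∈ Z ↔ x ∈ P ∨ (x ∈ K' ∧ compK x ≠ compK c) := fun x => by
    simp only [hZ_def, Finset.mem_union, Finset.mem_filter]
  have hZconn : G.IsConnectedOn Z := by
    refine G.isConnectedOn_blockBase hcompK hPconn hbP (P := fun C => C ≠ compK c)
      (fun v hv _ => ?_) hZ
    exact Finset.nonempty_iff_ne_empty.2 fun h0 => hndol
      (G.isDOL_of_ladderComp_not_P hev h2 ha hb hab hsk hW hbP haP huP hPconn hbd hK' hcompK hv h0)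
  have hJconn : G.IsConnectedOn (compK c) := G.isConnectedOn_of_comp hc hJ
  have h3A : 3 ≤ (G.linesBetween {a} {a}ᶜ).card :=
    (G.three_le_card_bdry hev h2 ha hb hab hsk (Finset.mem_singleton_self a)
      (fun h => hab (Finset.mem_singleton.1 h).symm)).1
  have h3Z : 3 ≤ (G.linesBetween (compK c) Z).card :=
    h3.trans (Finset.card_le_card (G.linesBetween_mono_right _ Finset.subset_union_left))
  have haJd : Disjoint {a} (compK c) := Finset.disjoint_singleton_left.2 haJ
  have haZ : Disjoint {a} Z := Finset.disjoint_singleton_left.2 fun h => by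
    rcases (hZ a).1 h with h | ⟨h, -⟩
    · exact haP h
    · exact haK' h
  have hJZ : Disjoint (compK c) Z := Finset.disjoint_left.2 fun x hxJ hxZ => by
    rcases (hZ x).1 hxZ with h | ⟨-, hne⟩
    · exact Finset.disjoint_left.1 hJP hxJ h
    · exact hne (G.comp_eq_comp_of_mem (hcompK x) hJ (G.mem_comp_self (hcompK x)) hxJ)
  have hcover : ∀ v, v ∈ ({a} : Finset V) ∨ v ∈ compK c ∨ v ∈ Z := by
    intro v
    by_cases hva : v = a
    · exact Or.inl (Finset.mem_singleton.2 hva)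
    by_cases hvP : v ∈ P
    · exact Or.inr (Or.inr ((hZ v).2 (Or.inl hvP)))
    have hvK' : v ∈ K' := hmemK' v hvP hva
    by_cases hvJ : v ∈ compK c
    · exact Or.inr (Or.inl hvJ)
    · exact Or.inr (Or.inr ((hZ v).2 (Or.inr ⟨hvK', hcomp_ne v hvK' hvJ⟩)))
  exact G.isDOL_of_threeBlocks haJd haZ hJZ hcover (G.isConnectedOn_singleton a) hJconn hZconn
    h3A h3Z

end LadderBlocks


section LadderMain

variable [Fintype V] [Fintype L] [DecidableEq V] [DecidableEq L]

omit [Fintype V] [DecidableEq L] in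
/-- A line between `X` and `B` joining `u` to `v` has `u` or `v` in `X`.
[cite: FeldmanSalmhoferTrubowitz1999, Lemma 2.5 (proof) p0005:L92-95] -/
theorem mem_or_mem_of_mem_linesBetween {X B : Finset V} {l : L} (hl : l ∈ G.linesBetween X B)
    {u v : V} (hj : G.Joins l u v) : u ∈ X ∨ v ∈ X := by
  rw [mem_linesBetween] at hl
  rcases hl with ⟨h1, h2⟩ | ⟨h1, h2⟩ <;> rcases hj with ⟨h3, h4⟩ | ⟨h3, h4⟩
  · exact Or.inl (h3 ▸ h1)
  · exact Or.inr (h3 ▸ h1)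
  · exact Or.inr (h4 ▸ h2)
  · exact Or.inl (h4 ▸ h2)

/-- LADDER STEP, the two tip lines meet ONE vertex. In a ladder state whose outside `K' = W - P`
is a single component `J` with two lines to `a` and whose two reduced-boundary lines `e₁ ≠ e₂` run
from the tip `u` to `v₁, v₂ ∈ J`: `v₁ = v₂`. Otherwise separate `v₁ | v₂` inside `J` by connected
blocks `X ∋ v₁`, `Y ∋ v₂` (`exists_separation`); two or more `X–Y` lines give the DOL blocks
`{a} | Y | P ∪ X`; at most one contradicts parity (`|∂X| = x_a + 1 + ℓ`, `|∂Y| = y_a + 1 + ℓ`, both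
even and `≠ 2`, `x_a + y_a = 2`). [cite: FeldmanSalmhoferTrubowitz1999, §2.2 p0006:L84-103] -/
theorem ladder_ends_eq (hev : G.EvenIncidence) (h2 : G.IsTwoLegged) {a b : V} (ha : G.ext a = 1)
    (hb : G.ext b = 1) (hab : a ≠ b) (hsk : G.IsSkeleton) (hndol : ¬ G.IsDOL) {W : Finset V}
    (hW : ∀ x, x ∈ W ↔ x ≠ a ∧ x ≠ b) {P : Finset V} {u : V} (hbP : b ∈ P) (haP : a ∉ P)
    (huP : u ∈ P) (hPconn : G.IsConnectedOn P) {K' : Finset V} (hK' : K' = W \ P)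
    {J : Finset V} {c : V} (hc : c ∈ K') (hJ : ∀ x, x ∈ J ↔ G.Reachable (G.induced K') c x)
    (hK'J : ∀ x ∈ K', x ∈ J) (hJa2 : (G.linesBetween J {a}).card = 2)
    {e₁ e₂ : L} (hne : e₁ ≠ e₂) (hJPe : G.linesBetween J P = {e₁, e₂})
    {v₁ v₂ : V} (hv₁ : v₁ ∈ J) (hv₂ : v₂ ∈ J) (hj₁ : G.Joins e₁ u v₁) (hj₂ : G.Joins e₂ u v₂) :
    v₁ = v₂ := by
  classical
  by_contra hvne
  have hJK : J ⊆ K' := G.comp_subset hc hJ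
  have hK'W : K' ⊆ W := fun x hx => (Finset.mem_sdiff.1 (hK' ▸ hx)).1
  have hK'P : ∀ x ∈ K', x ∉ P := fun x hx => (Finset.mem_sdiff.1 (hK' ▸ hx)).2
  have hJP : Disjoint J P := Finset.disjoint_left.2 fun x hx hxP => hK'P x (hJK hx) hxP
  have haJ : a ∉ J := fun h => ((hW a).1 (hK'W (hJK h))).1 rfl
  have hbJ : b ∉ J := fun h => ((hW b).1 (hK'W (hJK h))).2 rfl
  have huJ : u ∉ J := fun h => Finset.disjoint_left.1 hJP h huP
  obtain ⟨X, Y, hXY, hXYJ, hv₁X, hv₂Y, hXconn, hYconn⟩ :=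
    G.exists_separation (G.isConnectedOn_of_comp hc hJ) hv₁ hv₂ hvne
  have hXJ : X ⊆ J := hXYJ ▸ Finset.subset_union_left
  have hYJ : Y ⊆ J := hXYJ ▸ Finset.subset_union_right
  have hXP : Disjoint X P := Finset.disjoint_of_subset_left hXJ hJP
  have hYP : Disjoint Y P := Finset.disjoint_of_subset_left hYJ hJP
  have haX : a ∉ X := fun h => haJ (hXJ h)
  have haY : a ∉ Y := fun h => haJ (hYJ h)
  have hbX : b ∉ X := fun h => hbJ (hXJ h)
  have hbY : b ∉ Y := fun h => hbJ (hYJ h)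
  have hv₁Y : v₁ ∉ Y := fun h => Finset.disjoint_left.1 hXY hv₁X h
  have hv₂X : v₂ ∉ X := fun h => Finset.disjoint_left.1 hXY h hv₂Y
  -- the lines to `P` from each side
  have hXPe : G.linesBetween X P = {e₁} := by
    refine Finset.eq_singleton_iff_unique_mem.2 ⟨G.mem_linesBetween_of_joins hj₁.symm hv₁X huP, ?_⟩
    intro l hl
    have hl' : l ∈ G.linesBetween J P := G.linesBetween_mono_left hXJ P hl
    rw [hJPe, Finset.mem_insert, Finset.mem_singleton] at hl'
    rcases hl' with rfl | rfl
    · rfl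
    · rcases G.mem_or_mem_of_mem_linesBetween hl hj₂ with h | h
      · exact absurd (hXJ h) huJ
      · exact absurd h hv₂X
  have hYPe : G.linesBetween Y P = {e₂} := by
    refine Finset.eq_singleton_iff_unique_mem.2 ⟨G.mem_linesBetween_of_joins hj₂.symm hv₂Y huP, ?_⟩
    intro l hl
    have hl' : l ∈ G.linesBetween J P := G.linesBetween_mono_left hYJ P hl
    rw [hJPe, Finset.mem_insert, Finset.mem_singleton] at hl'
    rcases hl' with rfl | rfl
    · rcases G.mem_or_mem_of_mem_linesBetween hl hj₁ with h | h
      · exact absurd (hYJ h) huJ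
      · exact absurd h hv₁Y
    · rfl
  by_cases hXY2 : 2 ≤ (G.linesBetween Y X).card
  · -- DOL: blocks `{a} | Y | P ∪ X`
    apply hndol
    have hZconn : G.IsConnectedOn (P ∪ X) := G.isConnectedOn_union_of_joins hPconn hXconn huP hv₁X hj₁
    have haYd : Disjoint {a} Y := Finset.disjoint_singleton_left.2 haY
    have haZ : Disjoint {a} (P ∪ X) := Finset.disjoint_singleton_left.2 fun h => by
      rcases Finset.mem_union.1 h with h | h
      · exact haP h
      · exact haX h
    have hYZ : Disjoint Y (P ∪ X) := Finset.disjoint_union_right.2 ⟨hYP, hXY.symm⟩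
    have hcover : ∀ v, v ∈ ({a} : Finset V) ∨ v ∈ Y ∨ v ∈ P ∪ X := by
      intro v
      by_cases hva : v = a
      · exact Or.inl (Finset.mem_singleton.2 hva)
      by_cases hvP : v ∈ P
      · exact Or.inr (Or.inr (Finset.mem_union_left _ hvP))
      have hvK' : v ∈ K' :=
        hK' ▸ Finset.mem_sdiff.2 ⟨(hW v).2 ⟨hva, fun hvb => hvP (hvb ▸ hbP)⟩, hvP⟩
      have hvJ : v ∈ X ∪ Y := hXYJ ▸ hK'J v hvK'
      rcases Finset.mem_union.1 hvJ with h | h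
      · exact Or.inr (Or.inr (Finset.mem_union_right _ h))
      · exact Or.inr (Or.inl h)
    have h3A : 3 ≤ (G.linesBetween {a} {a}ᶜ).card :=
      (G.three_le_card_bdry hev h2 ha hb hab hsk (Finset.mem_singleton_self a)
        (fun h => hab (Finset.mem_singleton.1 h).symm)).1
    have h3 : 3 ≤ (G.linesBetween Y (P ∪ X)).card := by
      rw [G.linesBetween_union_right,
        Finset.card_union_of_disjoint (G.disjoint_linesBetween hYP hXY.symm hXP.symm), hYPe,
        Finset.card_singleton]
      omega
    exact G.isDOL_of_threeBlocks haYd haZ hYZ hcover (G.isConnectedOn_singleton a) hYconn hZconn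
      h3A h3
  · -- parity contradiction
    have hXne : X.Nonempty := ⟨v₁, hv₁X⟩
    have hYne : Y.Nonempty := ⟨v₂, hv₂Y⟩
    obtain ⟨⟨rX, hrX⟩, hX2, -⟩ := G.card_linesBetween_compl_of_avoids hev h2 ha hb hab hsk haX hbX hXne
    obtain ⟨⟨rY, hrY⟩, hY2, -⟩ := G.card_linesBetween_compl_of_avoids hev h2 ha hb hab hsk haY hbY hYne
    -- the complement of each side, as far as lines from it are concerned
    have hcomplX : G.linesBetween X Xᶜ = G.linesBetween X ({a} ∪ P ∪ Y) := by
      ext l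
      constructor
      · intro hl
        obtain ⟨x, hx, z, hz, hj⟩ := G.exists_joins_of_mem_bdry hl
        refine G.mem_linesBetween_of_joins hj hx ?_
        rw [Finset.mem_union, Finset.mem_union, Finset.mem_singleton]
        by_cases hza : z = a
        · exact Or.inl (Or.inl hza)
        by_cases hzP : z ∈ P
        · exact Or.inl (Or.inr hzP)
        have hzK' : z ∈ K' :=
          hK' ▸ Finset.mem_sdiff.2 ⟨(hW z).2 ⟨hza, fun hzb => hzP (hzb ▸ hbP)⟩, hzP⟩
        have hzJ : z ∈ X ∪ Y := hXYJ ▸ hK'J z hzK'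
        exact Or.inr ((Finset.mem_union.1 hzJ).resolve_left hz)
      · intro hl
        obtain ⟨x, hx, z, hz, hj⟩ := G.exists_joins_of_mem_linesBetween hl
        refine G.mem_bdry_of_joins hj hx ?_
        rw [Finset.mem_union, Finset.mem_union, Finset.mem_singleton] at hz
        rcases hz with (rfl | hzP) | hzY
        · exact haX
        · exact fun h => Finset.disjoint_left.1 hXP h hzP
        · exact fun h => Finset.disjoint_left.1 hXY h hzY
    have hcomplY : G.linesBetween Y Yᶜ = G.linesBetween Y ({a} ∪ P ∪ X) := by
      ext l
      constructor
      · intro hl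
        obtain ⟨x, hx, z, hz, hj⟩ := G.exists_joins_of_mem_bdry hl
        refine G.mem_linesBetween_of_joins hj hx ?_
        rw [Finset.mem_union, Finset.mem_union, Finset.mem_singleton]
        by_cases hza : z = a
        · exact Or.inl (Or.inl hza)
        by_cases hzP : z ∈ P
        · exact Or.inl (Or.inr hzP)
        have hzK' : z ∈ K' :=
          hK' ▸ Finset.mem_sdiff.2 ⟨(hW z).2 ⟨hza, fun hzb => hzP (hzb ▸ hbP)⟩, hzP⟩
        have hzJ : z ∈ X ∪ Y := hXYJ ▸ hK'J z hzK'
        exact Or.inr ((Finset.mem_union.1 hzJ).resolve_right hz)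
      · intro hl
        obtain ⟨x, hx, z, hz, hj⟩ := G.exists_joins_of_mem_linesBetween hl
        refine G.mem_bdry_of_joins hj hx ?_
        rw [Finset.mem_union, Finset.mem_union, Finset.mem_singleton] at hz
        rcases hz with (rfl | hzP) | hzX
        · exact haY
        · exact fun h => Finset.disjoint_left.1 hYP h hzP
        · exact fun h => Finset.disjoint_left.1 hXY hzX h
    have haPd : Disjoint ({a} : Finset V) P := Finset.disjoint_singleton_left.2 haP
    have haXd : Disjoint X {a} := Finset.disjoint_singleton_right.2 haX
    have haYd : Disjoint Y {a} := Finset.disjoint_singleton_right.2 haY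
    have hcardX : (G.linesBetween X Xᶜ).card =
        (G.linesBetween X {a}).card + 1 + (G.linesBetween X Y).card := by
      rw [hcomplX, G.linesBetween_union_right, G.linesBetween_union_right,
        Finset.card_union_of_disjoint, Finset.card_union_of_disjoint (G.disjoint_linesBetween haXd hXP haPd),
        hXPe, Finset.card_singleton]
      rw [← G.linesBetween_union_right]
      refine G.disjoint_linesBetween ?_ hXY ?_
      · exact Finset.disjoint_union_right.2 ⟨haXd, hXP⟩
      · exact Finset.disjoint_union_left.2 ⟨Finset.disjoint_singleton_left.2 haY, hYP.symm⟩
    have hcardY : (G.linesBetween Y Yᶜ).card =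
        (G.linesBetween Y {a}).card + 1 + (G.linesBetween Y X).card := by
      rw [hcomplY, G.linesBetween_union_right, G.linesBetween_union_right,
        Finset.card_union_of_disjoint, Finset.card_union_of_disjoint (G.disjoint_linesBetween haYd hYP haPd),
        hYPe, Finset.card_singleton]
      rw [← G.linesBetween_union_right]
      refine G.disjoint_linesBetween ?_ hXY.symm ?_
      · exact Finset.disjoint_union_right.2 ⟨haYd, hYP⟩
      · exact Finset.disjoint_union_left.2 ⟨Finset.disjoint_singleton_left.2 haX, hXP.symm⟩
    have hsum : (G.linesBetween X {a}).card + (G.linesBetween Y {a}).card = 2 := by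
      rw [← hJa2, ← hXYJ, G.linesBetween_union_left, Finset.card_union_of_disjoint]
      rw [G.linesBetween_comm X {a}, G.linesBetween_comm Y {a}]
      exact G.disjoint_linesBetween (Finset.disjoint_singleton_left.2 haX)
        (Finset.disjoint_singleton_left.2 haY) hXY
    have hcommXY : (G.linesBetween Y X).card = (G.linesBetween X Y).card := by
      rw [G.linesBetween_comm]
    omega

end LadderMain


section LadderStepMain

variable [Fintype V] [Fintype L] [DecidableEq V] [DecidableEq L]

/-- **THE LADDER STEP.** In a ladder state (`b ∈ P ∌ a`, `G[P]` connected, every boundary line of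
`P` other than the `a–b` line sits at the tip `u`) of a non-DOL graph with `m = 1` and two lines
from the inner vertices to `a`, the reduced boundary of `P` consists of EXACTLY TWO lines and both
join `u` to ONE vertex `v ∉ P`; moreover `v = a` only when all inner vertices are already in `P`.
(Components of `G - a - P`: all joined to `a` and to `P` — configurations 1, 2; `a`'s two free
lines bound their number; three lines into `P` — configuration 3; the last alternative is
`ladder_ends_eq`.) This is the inductive content of "`G` must then look as in Figure 13 … or as in
Figure 14, the wicked ladder" (p0006:L95-103), obtained here without FST I's Lemma 2.26.
[cite: FeldmanSalmhoferTrubowitz1999, §2.2 p0006:L84-108] -/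
theorem ladder_step (hev : G.EvenIncidence) (h2 : G.IsTwoLegged) {a b : V} (ha : G.ext a = 1)
    (hb : G.ext b = 1) (hab : a ≠ b) (hsk : G.IsSkeleton) (hndol : ¬ G.IsDOL) {W : Finset V}
    (hW : ∀ x, x ∈ W ↔ x ≠ a ∧ x ≠ b) (hWa : (G.linesBetween W {a}).card = 2)
    (hm : (G.linesBetween {a} {b}).card = 1) {P : Finset V} {u : V} (hbP : b ∈ P) (haP : a ∉ P)
    (huP : u ∈ P) (hPconn : G.IsConnectedOn P)
    (hbd : ∀ l ∈ G.linesBetween P Pᶜ, ¬ G.Joins l a b → G.fst l = u ∨ G.snd l = u) :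
    ∃ v, v ∉ P ∧ (v = a ∨ v ∈ W) ∧ ¬ (u = b ∧ v = a) ∧
      ((G.linesBetween P Pᶜ).filter fun l => ¬ G.Joins l a b).card = 2 ∧
      (∀ l ∈ (G.linesBetween P Pᶜ).filter (fun l => ¬ G.Joins l a b), G.Joins l u v) ∧
      (v = a → W ⊆ P) := by
  classical
  obtain ⟨⟨r, hr⟩, hE2⟩ := G.card_reducedBdry hev h2 ha hb hab hsk hm hbP haP
  set E := (G.linesBetween P Pᶜ).filter fun l => ¬ G.Joins l a b with hE_def
  set K' := W \ P with hK'_def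
  set compK : V → Finset V := fun c => Finset.univ.filter (fun x => G.Reachable (G.induced K') c x)
    with hcompK_def
  have hcompK : ∀ c x, x ∈ compK c ↔ G.Reachable (G.induced K') c x := fun c x => by
    simp [hcompK_def]
  have hK'W : K' ⊆ W := fun x hx => (Finset.mem_sdiff.1 hx).1
  have hK'P : ∀ x ∈ K', x ∉ P := fun x hx => (Finset.mem_sdiff.1 hx).2
  have haW : a ∉ W := fun h => ((hW a).1 h).1 rfl
  have hmemK' : ∀ y, y ∉ P → y ∈ W → y ∈ K' := fun y hy hyW => Finset.mem_sdiff.2 ⟨hyW, hy⟩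
  have houter := fun l (hl : l ∈ E) => G.exists_outer_end hW hbP huP hbd hl
  -- every component of `G - a - P` is joined to `a`; two at most three lines rule
  have hatt_a : ∀ c ∈ K', (G.linesBetween (compK c) {a}).Nonempty := fun c hc =>
    Finset.nonempty_iff_ne_empty.2 fun h0 => hndol
      (G.isDOL_of_ladderComp_not_a hev h2 ha hb hab hsk hW hbP haP huP hPconn hbd rfl hcompK hc h0)
  have hle_a : ∀ c ∈ K', (G.linesBetween (compK c) {a}).card ≤ 2 := fun c hc =>
    hWa ▸ Finset.card_le_card
      (G.linesBetween_mono_left ((G.comp_subset hc (hcompK c)).trans hK'W) {a})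
  have hno3 : ∀ c ∈ K', ¬ 3 ≤ (G.linesBetween (compK c) P).card := fun c hc h3 =>
    G.false_of_ladderComp_three hev h2 ha hb hab hsk hndol hW hbP haP huP hPconn hbd rfl hcompK hc h3
  by_cases hEa : ∃ l ∈ E, G.Joins l u a
  · -- CASE A: a free line from the tip reaches `a`: this is the last step
    obtain ⟨l₀, hl₀E, hl₀⟩ := hEa
    have hub : u ≠ b := by
      rintro rfl
      exact (Finset.mem_filter.1 hl₀E).2 hl₀.symm
    have hua : u ≠ a := fun h => haP (h ▸ huP)
    have huW : u ∈ W := (hW u).2 ⟨hua, hub⟩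
    have hl₀' : l₀ ∈ G.linesBetween {u} {a} :=
      G.mem_linesBetween_of_joins hl₀ (Finset.mem_singleton_self _) (Finset.mem_singleton_self _)
    have hK'e : ∀ c, c ∉ K' := by
      intro c hc
      have hJ := hcompK c
      obtain ⟨hJP, haJ, hbJ, -, -, hcardJ, -⟩ :=
        G.card_bdry_ladderComp hW hbP haP huP hbd rfl hc hJ
      obtain ⟨⟨r', hr'⟩, hne2, h1⟩ := G.card_linesBetween_compl_of_avoids hev h2 ha hb hab hsk haJ hbJ
        ⟨c, G.mem_comp_self hJ⟩
      have huJ : u ∉ compK c := fun h => Finset.disjoint_left.1 hJP h huP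
      have hdisj : Disjoint (G.linesBetween (compK c) {a}) (G.linesBetween {u} {a}) := by
        rw [G.linesBetween_comm (compK c) {a}, G.linesBetween_comm {u} {a}]
        exact G.disjoint_linesBetween (Finset.disjoint_singleton_left.2 haJ)
          (Finset.disjoint_singleton.2 hua.symm) (Finset.disjoint_singleton_right.2 huJ)
      have hsub : G.linesBetween (compK c) {a} ∪ G.linesBetween {u} {a} ⊆ G.linesBetween W {a} :=
        Finset.union_subset
          (G.linesBetween_mono_left ((G.comp_subset hc hJ).trans hK'W) {a})
          (G.linesBetween_mono_left (Finset.singleton_subset_iff.2 huW) {a})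
      have hle := Finset.card_le_card hsub
      rw [Finset.card_union_of_disjoint hdisj, hWa] at hle
      have h1u : 1 ≤ (G.linesBetween {u} {a}).card := Finset.card_pos.2 ⟨l₀, hl₀'⟩
      have h1a : 1 ≤ (G.linesBetween (compK c) {a}).card := Finset.card_pos.2 (hatt_a c hc)
      exact hno3 c hc (by omega)
    have hWP : W ⊆ P := fun x hxW => by
      by_contra hxP
      exact hK'e x (hmemK' x hxP hxW)
    have hEa' : ∀ l ∈ E, G.Joins l u a := by
      intro l hl
      obtain ⟨y, hyP, hj, hya⟩ := houter l hl
      rcases hya with rfl | hyW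
      · exact hj
      · exact absurd (hWP hyW) hyP
    have hEsub : E ⊆ G.linesBetween W {a} := fun l hl =>
      G.mem_linesBetween_of_joins (hEa' l hl) huW (Finset.mem_singleton_self a)
    have hEcard : E.card = 2 := le_antisymm (hWa ▸ Finset.card_le_card hEsub) hE2
    exact ⟨a, haP, Or.inl rfl, fun h => hub h.1, hEcard, hEa', fun _ => hWP⟩
  · -- CASE B: both free lines of the tip go to inner vertices
    have houter' : ∀ l ∈ E, ∃ y ∈ K', G.Joins l u y := by
      intro l hl
      obtain ⟨y, hyP, hj, hya⟩ := houter l hl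
      rcases hya with rfl | hyW
      · exact absurd ⟨l, hl, hj⟩ hEa
      · exact ⟨y, hmemK' y hyP hyW, hj⟩
    obtain ⟨l₁, hl₁⟩ : E.Nonempty := Finset.card_pos.1 (by omega)
    obtain ⟨y₁, hy₁, hjy₁⟩ := houter' l₁ hl₁
    have hJ := hcompK y₁
    obtain ⟨hJP, haJ, hbJ, -, -, hcardJ, -⟩ :=
      G.card_bdry_ladderComp hW hbP haP huP hbd rfl hy₁ hJ
    obtain ⟨⟨r', hr'⟩, hne2, h1⟩ := G.card_linesBetween_compl_of_avoids hev h2 ha hb hab hsk haJ hbJ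
      ⟨y₁, G.mem_comp_self hJ⟩
    have hαpos : 0 < (G.linesBetween (compK y₁) {a}).card := Finset.card_pos.2 (hatt_a y₁ hy₁)
    have hαle := hle_a y₁ hy₁
    have hJP3 := hno3 y₁ hy₁
    -- the component is all of `K'`: a second component would also need a line to `a`
    have hK'J : ∀ c ∈ K', c ∈ compK y₁ := by
      intro c hc
      by_contra hcJ
      have hJ' := hcompK c
      have hne : compK c ≠ compK y₁ := fun h => hcJ (h ▸ G.mem_comp_self hJ')
      have haJ' : a ∉ compK c := fun h => haW (hK'W (G.comp_subset hc hJ' h))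
      have hdisjV : Disjoint (compK y₁) (compK c) := Finset.disjoint_left.2 fun x hx hx' =>
        hne (G.comp_eq_comp_of_mem hJ' hJ hx' hx)
      have hdisjL : Disjoint (G.linesBetween (compK y₁) {a}) (G.linesBetween (compK c) {a}) := by
        rw [G.linesBetween_comm (compK y₁) {a}, G.linesBetween_comm (compK c) {a}]
        exact G.disjoint_linesBetween (Finset.disjoint_singleton_left.2 haJ)
          (Finset.disjoint_singleton_left.2 haJ') hdisjV
      have hsub : G.linesBetween (compK y₁) {a} ∪ G.linesBetween (compK c) {a} ⊆
          G.linesBetween W {a} :=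
        Finset.union_subset (G.linesBetween_mono_left ((G.comp_subset hy₁ hJ).trans hK'W) {a})
          (G.linesBetween_mono_left ((G.comp_subset hc hJ').trans hK'W) {a})
      have hle := Finset.card_le_card hsub
      rw [Finset.card_union_of_disjoint hdisjL, hWa] at hle
      have h1c : 1 ≤ (G.linesBetween (compK c) {a}).card := Finset.card_pos.2 (hatt_a c hc)
      -- so the component of `y₁` has exactly one line to `a`, and then ≥ 3 lines into `P`
      exact hJP3 (by omega)
    have hα2 : (G.linesBetween (compK y₁) {a}).card = 2 := by
      by_contra hα
      exact hJP3 (by omega)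
    have hJP2 : (G.linesBetween (compK y₁) P).card = 2 := by omega
    have hEsub : E ⊆ G.linesBetween (compK y₁) P := by
      intro l hl
      obtain ⟨y, hy, hj⟩ := houter' l hl
      exact G.mem_linesBetween_of_joins hj.symm (hK'J y hy) huP
    have hEeq : E = G.linesBetween (compK y₁) P :=
      Finset.eq_of_subset_of_card_le hEsub (by rw [hJP2]; exact hE2)
    have hEcard : E.card = 2 := by rw [hEeq, hJP2]
    obtain ⟨e₁, e₂, hne12, hE12⟩ := Finset.card_eq_two.1 hEcard
    have he₁ : e₁ ∈ E := by rw [hE12]; simp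
    have he₂ : e₂ ∈ E := by rw [hE12]; simp
    obtain ⟨v₁, hv₁, hjv₁⟩ := houter' e₁ he₁
    obtain ⟨v₂, hv₂, hjv₂⟩ := houter' e₂ he₂
    have hv12 : v₁ = v₂ :=
      G.ladder_ends_eq hev h2 ha hb hab hsk hndol hW hbP haP huP hPconn rfl hy₁ hJ hK'J hα2 hne12
        (hEeq ▸ hE12) (hK'J v₁ hv₁) (hK'J v₂ hv₂) hjv₁ hjv₂
    have hv₁W : v₁ ∈ W := hK'W hv₁
    refine ⟨v₁, hK'P v₁ hv₁, Or.inr hv₁W, fun h => ((hW v₁).1 hv₁W).1 h.2, hEcard, ?_,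
      fun h => absurd h ((hW v₁).1 hv₁W).1⟩
    intro l hl
    rw [hE12, Finset.mem_insert, Finset.mem_singleton] at hl
    rcases hl with rfl | rfl
    · exact hjv₁
    · exact hv12 ▸ hjv₂

end LadderStepMain


section LadderInduction

variable [Fintype V] [Fintype L] [DecidableEq V] [DecidableEq L]

omit [Fintype V] [DecidableEq L] in
/-- After a ladder step: exactly two lines join the tip `u` to the new vertex `v`.
[cite: FeldmanSalmhoferTrubowitz1999, §2.2 p0006:L95-103] -/
theorem lineCount_tip_eq_two [Fintype V] {a b : V} {P : Finset V} {u v : V} (haP : a ∉ P)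
    (huP : u ∈ P) (hvP : v ∉ P) (hubva : ¬ (u = b ∧ v = a))
    (hE2 : ((G.linesBetween P Pᶜ).filter fun l => ¬ G.Joins l a b).card = 2)
    (hEall : ∀ l ∈ (G.linesBetween P Pᶜ).filter (fun l => ¬ G.Joins l a b), G.Joins l u v) :
    G.lineCount u v = 2 := by
  unfold lineCount
  rw [← hE2]
  congr 1
  ext l
  simp only [Finset.mem_filter, Finset.mem_univ, true_and]
  constructor
  · intro hj
    refine ⟨G.mem_linesBetween_of_joins hj huP (Finset.mem_compl.2 hvP), fun hjab => ?_⟩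
    have hua : u ≠ a := fun h => haP (h ▸ huP)
    rcases hj with ⟨h1, h2⟩ | ⟨h1, h2⟩ <;> rcases hjab with ⟨h3, h4⟩ | ⟨h3, h4⟩
    · exact hua (h1.symm.trans h3)
    · exact hubva ⟨h1.symm.trans h3, h2.symm.trans h4⟩
    · exact hubva ⟨h2.symm.trans h4, h1.symm.trans h3⟩
    · exact hua (h2.symm.trans h4)
  · rintro ⟨hl, hnab⟩
    exact hEall l (Finset.mem_filter.2 ⟨hl, hnab⟩)

omit [Fintype V] [DecidableEq L] in
/-- After a ladder step: no line joins the new vertex `v` to a vertex `x ≠ u` of `P` (other than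
the `a–b` line, in the final step `v = a`, `x = b`). [cite: FeldmanSalmhoferTrubowitz1999, §2.2 p0006:L95-103] -/
theorem lineCount_new_eq_zero [Fintype V] {a b : V} {P : Finset V} {u v : V} (hbP : b ∈ P)
    (huP : u ∈ P) (hvP : v ∉ P)
    (hbd : ∀ l ∈ G.linesBetween P Pᶜ, ¬ G.Joins l a b → G.fst l = u ∨ G.snd l = u)
    {x : V} (hxP : x ∈ P) (hxu : x ≠ u) (hvaxb : ¬ (v = a ∧ x = b)) : G.lineCount v x = 0 := by
  unfold lineCount
  rw [Finset.card_eq_zero, Finset.eq_empty_iff_forall_notMem]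
  intro l hl
  rw [Finset.mem_filter] at hl
  obtain ⟨-, hj⟩ := hl
  have hbd_l : l ∈ G.linesBetween P Pᶜ :=
    G.mem_linesBetween_of_joins hj.symm hxP (Finset.mem_compl.2 hvP)
  have hvb : v ≠ b := fun h => hvP (h ▸ hbP)
  have hnab : ¬ G.Joins l a b := by
    intro hjab
    rcases hj with ⟨h1, h2⟩ | ⟨h1, h2⟩ <;> rcases hjab with ⟨h3, h4⟩ | ⟨h3, h4⟩
    · exact hvaxb ⟨h1.symm.trans h3, h2.symm.trans h4⟩
    · exact hvb (h1.symm.trans h3)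
    · exact hvb (h2.symm.trans h4)
    · exact hvaxb ⟨h2.symm.trans h4, h1.symm.trans h3⟩
  have hu := hbd l hbd_l hnab
  rcases hj with ⟨h1, h2⟩ | ⟨h1, h2⟩ <;> rcases hu with hu | hu
  · exact hvP (h1.symm.trans hu ▸ huP)
  · exact hxu (h2.symm.trans hu)
  · exact hxu (h1.symm.trans hu)
  · exact hvP (h2.symm.trans hu ▸ huP)

/-- **THE LADDER INDUCTION.** Growing `P` from `{b}` one vertex at a time by `ladder_step`, recording
the vertices as `w : Fin (k+1) → V` (`w 0` = the tip, `w (last k) = b`) with the ladder line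
counts, until the tip's two free lines reach `a`; then all vertices are used up and
`a, w 0, …, w k = b` is a wicked ladder with `k + 1 ≥ 2` bubbles (induction on the number `d` of
vertices outside `P`). [cite: FeldmanSalmhoferTrubowitz1999, Thm 2.6 p0006:L95-108] -/
theorem ladder_induction (hev : G.EvenIncidence) (h2 : G.IsTwoLegged) {a b : V} (ha : G.ext a = 1)
    (hb : G.ext b = 1) (hab : a ≠ b) (hsk : G.IsSkeleton) (hndol : ¬ G.IsDOL) {W : Finset V}
    (hW : ∀ x, x ∈ W ↔ x ≠ a ∧ x ≠ b) (hWne : W.Nonempty) (hWa : (G.linesBetween W {a}).card = 2)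
    (hm : (G.linesBetween {a} {b}).card = 1) :
    ∀ (d k : ℕ) (P : Finset V) (w : Fin (k + 1) → V),
      P.card + d = Fintype.card V → (∀ x, x ∈ P ↔ ∃ i, w i = x) → Function.Injective w →
      w (Fin.last k) = b → (∀ i, w i ≠ a) → G.IsConnectedOn P →
      (∀ l ∈ G.linesBetween P Pᶜ, ¬ G.Joins l a b → G.fst l = w 0 ∨ G.snd l = w 0) →
      (∀ i j : Fin (k + 1), i < j → G.lineCount (w i) (w j) = if (j : ℕ) = i + 1 then 2 else 0) →
      ∃ n : ℕ, 2 ≤ n ∧ G.IsWickedLadderShape a b n := by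
  classical
  intro d
  induction d with
  | zero =>
    intro k P w hcard hPw _ _ hwa _ _ _
    exfalso
    have hPu : P = Finset.univ := Finset.eq_univ_of_card P (by omega)
    obtain ⟨i, hi⟩ := (hPw a).1 (hPu ▸ Finset.mem_univ a)
    exact hwa i hi
  | succ d ih =>
    intro k P w hcard hPw hwinj hwlast hwa hPconn hbd htab
    have hbP : b ∈ P := (hPw b).2 ⟨Fin.last k, hwlast⟩
    have haP : a ∉ P := fun h => by
      obtain ⟨i, hi⟩ := (hPw a).1 h
      exact hwa i hi
    have huP : w 0 ∈ P := (hPw _).2 ⟨0, rfl⟩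
    have hPimg : P = Finset.univ.image w := by
      ext x; rw [hPw x]; simp [Finset.mem_image]
    have hPcard : P.card = k + 1 := by
      rw [hPimg, Finset.card_image_of_injective _ hwinj, Finset.card_univ, Fintype.card_fin]
    obtain ⟨v, hvP, hva, hubva, hE2, hEall, hfin⟩ :=
      G.ladder_step hev h2 ha hb hab hsk hndol hW hWa hm hbP haP huP hPconn hbd
    have htip : G.lineCount (w 0) v = 2 := G.lineCount_tip_eq_two haP huP hvP hubva hE2 hEall
    have hzero : ∀ x ∈ P, x ≠ w 0 → ¬ (v = a ∧ x = b) → G.lineCount v x = 0 :=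
      fun x hxP hxu hvaxb => G.lineCount_new_eq_zero hbP huP hvP hbd hxP hxu hvaxb
    have hvrange : v ∉ Set.range w := by
      rintro ⟨i, hi⟩
      exact hvP ((hPw v).2 ⟨i, hi⟩)
    have hne_of_ne : ∀ {i j : Fin (k + 1)}, i ≠ j → w i ≠ w j := fun h hw => h (hwinj hw)
    rcases hva with hva | hvW
    · -- FINAL STEP: `v = a`; the ladder is `a, w 0, …, w k = b`
      have hWP : W ⊆ P := hfin hva
      have hk : 1 ≤ k := by
        obtain ⟨c, hc⟩ := hWne
        have hcb : c ≠ b := ((hW c).1 hc).2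
        have h2 : ({b, c} : Finset V) ⊆ P := by
          intro x hx
          rw [Finset.mem_insert, Finset.mem_singleton] at hx
          rcases hx with rfl | rfl
          · exact hbP
          · exact hWP hc
        have := Finset.card_le_card h2
        rw [Finset.card_pair hcb.symm, hPcard] at this
        omega
      have huniv : ∀ x, x = a ∨ x ∈ P := by
        intro x
        by_cases hxa : x = a
        · exact Or.inl hxa
        by_cases hxb : x = b
        · exact Or.inr (hxb ▸ hbP)
        · exact Or.inr (hWP ((hW x).2 ⟨hxa, hxb⟩))
      have hcardV : Fintype.card V = k + 2 := by
        have : Finset.univ = insert a P := by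
          ext x
          simp only [Finset.mem_univ, Finset.mem_insert, true_iff]
          exact huniv x
        rw [← Finset.card_univ, this, Finset.card_insert_of_notMem haP, hPcard]
      refine ⟨k + 1, by omega, Fin.cons a w, ?_, Fin.cons_zero _ _, ?_, ?_⟩
      · rw [Fintype.bijective_iff_injective_and_card]
        refine ⟨Fin.cons_injective_iff.2 ⟨?_, hwinj⟩, by rw [Fintype.card_fin, hcardV]⟩
        rintro ⟨i, hi⟩
        exact hwa i hi
      · rw [← Fin.succ_last, Fin.cons_succ, hwlast]
      · intro i j hij
        rcases Fin.eq_zero_or_eq_succ j with hj | ⟨j', hj⟩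
        · exact absurd (hj ▸ hij) (Fin.not_lt.2 (Fin.zero_le i))
        subst hj
        rcases Fin.eq_zero_or_eq_succ i with hi | ⟨i', hi⟩
        · subst hi
          rw [Fin.cons_zero, Fin.cons_succ]
          split_ifs with hc1 hc2 hc2
          · exfalso
            simp only [Fin.ext_iff, Fin.val_succ, Fin.val_zero, Fin.val_last] at hc1 hc2
            omega
          · -- `j' = 0`: the tip
            simp only [Fin.val_succ, Fin.val_zero] at hc1
            have hj0 : j' = 0 := Fin.ext (by simpa using hc1)
            rw [hj0, G.lineCount_comm, ← hva, htip]
          · -- `j' = last k`: the `a–b` line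
            obtain ⟨-, hc2'⟩ := hc2
            rw [← Fin.succ_last, Fin.succ_inj] at hc2'
            rw [hc2', hwlast, G.lineCount_eq_card_linesBetween, hm]
          · -- a middle vertex
            have hj0 : j' ≠ 0 := by
              intro h; apply hc1; rw [h]; simp
            have hjl : j' ≠ Fin.last k := by
              intro h; apply hc2; exact ⟨rfl, by rw [h, Fin.succ_last]⟩
            rw [Nat.add_zero, ← hva]
            refine hzero (w j') ((hPw _).2 ⟨j', rfl⟩) (hne_of_ne hj0) ?_
            rintro ⟨-, hjb⟩
            exact hne_of_ne hjl (hjb.trans hwlast.symm)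
        · subst hi
          rw [Fin.cons_succ, Fin.cons_succ, htab i' j' (Fin.succ_lt_succ_iff.1 hij)]
          have hne0 : (Fin.succ i' : Fin (k + 2)) ≠ 0 := Fin.succ_ne_zero i'
          simp only [Fin.val_succ, hne0, false_and, if_false, Nat.add_zero]
          split_ifs with hc1 hc2 hc2 <;> omega
    · -- GENERIC STEP: add `v` at the front and recurse
      have hva : v ≠ a := ((hW v).1 hvW).1
      obtain ⟨e, he⟩ : ((G.linesBetween P Pᶜ).filter fun l => ¬ G.Joins l a b).Nonempty :=
        Finset.card_pos.1 (by omega)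
      refine ih (k + 1) (insert v P) (Fin.cons v w) ?_ ?_ ?_ ?_ ?_ ?_ ?_ ?_
      · rw [Finset.card_insert_of_notMem hvP]; omega
      · intro x
        rw [Finset.mem_insert, hPw]
        constructor
        · rintro (rfl | ⟨i, hi⟩)
          · exact ⟨0, Fin.cons_zero _ _⟩
          · exact ⟨i.succ, by rw [Fin.cons_succ, hi]⟩
        · rintro ⟨i, hi⟩
          rcases Fin.eq_zero_or_eq_succ i with h | ⟨i', h⟩
          · subst h; rw [Fin.cons_zero] at hi; exact Or.inl hi.symm
          · subst h; rw [Fin.cons_succ] at hi; exact Or.inr ⟨i', hi⟩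
      · exact Fin.cons_injective_iff.2 ⟨hvrange, hwinj⟩
      · rw [← Fin.succ_last, Fin.cons_succ, hwlast]
      · intro i
        rcases Fin.eq_zero_or_eq_succ i with h | ⟨i', h⟩
        · subst h; rw [Fin.cons_zero]; exact hva
        · subst h; rw [Fin.cons_succ]; exact hwa i'
      · exact G.isConnectedOn_insert_of_joins hPconn huP (hEall e he)
      · intro l hl hnab
        rw [Fin.cons_zero]
        rw [G.mem_bdry] at hl
        simp only [Finset.mem_insert, not_or] at hl
        rcases hl with ⟨hf | hf, hs1, hs2⟩ | ⟨⟨hf1, hf2⟩, hs | hs⟩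
        · exact Or.inl hf
        · exfalso
          have hlE : l ∈ (G.linesBetween P Pᶜ).filter fun l => ¬ G.Joins l a b :=
            Finset.mem_filter.2 ⟨G.mem_bdry.2 (Or.inl ⟨hf, hs2⟩), hnab⟩
          rcases hEall l hlE with ⟨h1, h2⟩ | ⟨h1, h2⟩
          · exact hs1 h2
          · exact hvP (h1 ▸ hf)
        · exact Or.inr hs
        · exfalso
          have hlE : l ∈ (G.linesBetween P Pᶜ).filter fun l => ¬ G.Joins l a b :=
            Finset.mem_filter.2 ⟨G.mem_bdry.2 (Or.inr ⟨hf2, hs⟩), hnab⟩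
          rcases hEall l hlE with ⟨h1, h2⟩ | ⟨h1, h2⟩
          · exact hvP (h2 ▸ hs)
          · exact hf1 h1
      · intro i j hij
        rcases Fin.eq_zero_or_eq_succ j with hj | ⟨j', hj⟩
        · exact absurd (hj ▸ hij) (Fin.not_lt.2 (Fin.zero_le i))
        subst hj
        rcases Fin.eq_zero_or_eq_succ i with hi | ⟨i', hi⟩
        · subst hi
          rw [Fin.cons_zero, Fin.cons_succ]
          split_ifs with hc1
          · simp only [Fin.val_succ, Fin.val_zero] at hc1
            have hj0 : j' = 0 := Fin.ext (by simpa using hc1)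
            rw [hj0, G.lineCount_comm, htip]
          · have hj0 : j' ≠ 0 := by
              intro h; apply hc1; rw [h]; simp
            exact hzero (w j') ((hPw _).2 ⟨j', rfl⟩) (hne_of_ne hj0) (fun h => hva h.1)
        · subst hi
          rw [Fin.cons_succ, Fin.cons_succ, htab i' j' (Fin.succ_lt_succ_iff.1 hij)]
          simp only [Fin.val_succ]
          split_ifs with hc1 hc2 hc2 <;> omega

end LadderInduction

end FGraph

/-! ### §11 Theorem 2.6 -/

/-- **Theorem 2.6 of FST III holds** (discharge of the named fact `theorem26`, licence F-036): a
non-DOL two-legged skeleton graph with even incidence numbers and its two external legs at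
distinct vertices `a ≠ b` is, modulo self-contractions, the sunset, a multiple sunset, or a wicked
ladder.  ROUTE (a direct replacement of the printed appeal to FST I's Lemma 2.22/2.26 — "If the
subgraphs are non-overlapping, they are dressed bubble chains by Lemma 2.26 of [FST I]",
p0006:L92-94 — by cuts of the graph itself, flagged as the one deviation from the print):
Theorem 2.4 forces `t = 1` (`exists_joins_of_not_isDOL`); every component of `G - {a, b}` is joined
to both `a` and `b` (`twoSided_of_not_isDOL`, the print's "`G₁` is overlapping and hence `G` is
DOL", p0006:L53-55), by exactly two lines each (`card_lines_comp_eq_two`), and there is at most one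
component (`comp_eq_of_not_isDOL`, the print's "for `a ≥ 2` components … the graph is DOL",
p0006:L58-63); no component gives the sunset / multiple sunset (`sunset_of_eq_empty`, p0006:L44-46);
one component forces `m = 1` (`card_lines_ab_eq_one`, p0006:L66-71) and then the ladder induction
(`ladder_induction`: from `b`, the two free lines at the tip of the ladder always continue to ONE
new vertex, `ladder_step`, until they reach `a`) exhibits the wicked ladder (p0006:L95-108).
[cite: FeldmanSalmhoferTrubowitz1999, Thm 2.6 p0006:L106-108] -/
theorem theorem26_holds : theorem26 := by
  intro V L _ _ _ _ G a b hev h2 ha hb hab hsk hndol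
  classical
  set W := ({a, b} : Finset V)ᶜ with hW_def
  have hW : ∀ x, x ∈ W ↔ x ≠ a ∧ x ≠ b := fun x => by
    simp only [hW_def, Finset.mem_compl, Finset.mem_insert, Finset.mem_singleton, not_or]
  by_cases hWe : W = ∅
  · rcases G.sunset_of_eq_empty hev h2 ha hb hab hsk hW hWe with h | h
    · exact Or.inl h
    · exact Or.inr (Or.inl h)
  obtain ⟨c, hc⟩ := Finset.nonempty_iff_ne_empty.2 hWe
  have hadj := G.exists_joins_of_not_isDOL hev h2 ha hb hab hsk hndol
  set comp : V → Finset V := fun v => Finset.univ.filter (fun x => G.Reachable (G.induced W) v x)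
    with hcomp_def
  have hcomp : ∀ v x, x ∈ comp v ↔ G.Reachable (G.induced W) v x := fun v x => by
    simp [hcomp_def]
  -- `W` is a single component
  have hKW : ∀ x, x ∈ W ↔ G.Reachable (G.induced W) c x := by
    intro x
    constructor
    · intro hx
      have heq : comp c = comp x :=
        G.comp_eq_of_not_isDOL hev h2 ha hb hab hsk hndol hadj hW hc hx (hcomp c) (hcomp x)
      exact (hcomp c x).1 (heq ▸ G.mem_comp_self (hcomp x))
    · intro hx
      exact G.comp_subset hc (hcomp c) ((hcomp c x).2 hx)
  obtain ⟨hWa, -⟩ := G.card_lines_comp_eq_two hev h2 ha hb hab hsk hndol hW hc hKW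
  have hm := G.card_lines_ab_eq_one hev h2 ha hb hab hsk hndol hW hc hKW
  -- start the ladder at `P = {b}`
  have hstart := G.ladder_induction hev h2 ha hb hab hsk hndol hW ⟨c, hc⟩ hWa hm
    (Fintype.card V - 1) 0 {b} (fun _ => b) (by
      have := Finset.card_le_univ ({b} : Finset V)
      rw [Finset.card_singleton] at this ⊢; omega)
    (fun x => by simp [Finset.mem_singleton, eq_comm])
    (fun i j _ => Fin.ext (by have := i.isLt; have := j.isLt; omega)) rfl (fun _ => hab.symm)
    (G.isConnectedOn_singleton b)
    (fun l hl _ => by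
      rcases G.mem_bdry.1 hl with ⟨h1, -⟩ | ⟨-, h2⟩
      · exact Or.inl (Finset.mem_singleton.1 h1)
      · exact Or.inr (Finset.mem_singleton.1 h2))
    (fun i j hij => absurd hij (by
      rw [Fin.lt_def]; have := i.isLt; have := j.isLt; omega))
  obtain ⟨n, hn, hlad⟩ := hstart
  exact Or.inr (Or.inr ⟨n, hn, hlad⟩)

end FST3

end Literature.MathematicalPhysics.QuantumLattice.FermiRG
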